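import Literature.MathematicalPhysics.QuantumFieldTheory.Balaban1983to89.Node00.Sect2FrameOfRecord
import Literature.MathematicalPhysics.QuantumFieldTheory.Balaban1983to89.Node00.Record12Residuals
import Literature.MathematicalPhysics.QuantumFieldTheory.Balaban1983to89.Node00.Record13NumericsOfThm1C
import Literature.MathematicalPhysics.QuantumFieldTheory.Balaban1983to89.Node00.BetaOfRecord
import Literature.MathematicalPhysics.QuantumFieldTheory.Balaban1983to89.B12Decay510
import Literature.MathematicalPhysics.QuantumFieldTheory.Balaban1983to89.Node00.Record13NumericsOfThm1CCMWZB
import Literature.MathematicalPhysics.QuantumFieldTheory.Balaban1983to89.Node00.BackgroundSelOfRecord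
import Literature.MathematicalPhysics.QuantumFieldTheory.Balaban1983to89.MatrixLog
import Literature.MathematicalPhysics.QuantumFieldTheory.Balaban1983to89.B12FormatPlus
import Literature.MathematicalPhysics.QuantumFieldTheory.Balaban1983to89.B12Eq18Current

/-!
# K0⁷ — THE RECORD-SIDE FORMAT NAMES (WORLD A): the data names the three NODE-O port texts `stmt-QuantumFields-27930⁗ ∕ 27931‴ ∕ 27932″`
# are written over, as DEFINITIONS over tree objects of record; (A2) definitional, (A3) proved, ROWS (N)∕(Mc)∕(W-labels) by `rfl`; elaboration receipts

Cell `ym-nodeO-ideate`, DEFINER seat `ym-nodeO-def-1` (gen 33), on director-ym №440's SUMMON (2026-08-30T21:35Z); typed against typer-1's `B12FormatPlus`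
(v3 ✓p791826: `FormatPlus ∕ Chart44 ∕ FormatPlusG ∕ FormatPlusW ∕ ChartEquivariant ∕ NoInvariantCovector`) and lens-1's port dictionary v11 (HOME draft,
parameter block of its §21); `--kind definition --supports stmt-QuantumFields-20541 --as helper`; count-neutral.  [I] = [Balaban1987RG1], [B11] = [Balaban1985Variational].

WHAT THIS FILE IS.  Every datum the texts quantify over, DEFINED from objects the tree holds, with N = 2, 𝔸 = `MatA 2`, the FINE lattice = level `0` of `F.P K`,
the unit lattice of the step = level `k + 1`; each name READS ONLY THE LETTERS ITS BODY READS (typer-1's rule; the dictionary's wider arities are filled by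
constant lambdas):
* §1 `M = recordBondCount F K` — the coordinates of print's `(𝐔, 𝐉)` = the matrix entries of 11b's `Sect2.CPair (F.P K) (MatA 2)` (`decodeCfg ∕ encodeCfg`);
  `m = recordChartDim F K` — three 𝔰𝔩₂(ℂ)-coordinates per fine bond (`sl2Gen ∕ sl2Coord ∕ chartMat`).
* §2 `recordDomSys F Mc k K := Sect2.domSys (F.P K) Mc (k+1)` (lens-1's abbrev verbatim); the coordinates «in X» `recordCoords`, chart inputs `recordCX`.
* §3 `recordUc F Mc k α₀ α₁ K X` = THE BODY of 11b's `Sect2.spaceI` at the `SU(2)` model, the record's residual §2 data `RzOfRecord F 2 K` and (1.12) constant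
  (`recordUc_eq_preimage_spaceI`).  SAID: `RzOfRecord` is the UNIT recipe of `Record12Residuals` («U_n(M˙(·)) ≡ 1»), NOT print's analytic backgrounds —
  (O2′)'s truth at the record is a statement about THIS space.
* §4 `recordChart F Mc k K X` — the coordinatewise EXP-CHART CUT TO `X` (`𝐔 = exp(Σ w_a τ_a)` on the bonds in `X`, `1` off `X`, `𝐉 = 0`; σ-blind); ROW (A3) chart
  input-locality is PROVED in the sibling lemma file `BalabanUVNodesK0RecordFormatNamesLemmas` (`recordChart_inputLocal`).
* §5 the two-volume window lifts `T_K ⊂ T_{K+1}` (`sitesPerDir_{K+1} j = L · sitesPerDir_K j` in Setup's standing range): `recordWrap` (domains meeting the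
  seam), `recordDomEmb`, `recordCoordProj`, `recordJX`.
* §6 the response-side geometry: `recordCc` (the tree's `tcubeSys` cover — its (0.26) leaf is the tree's `hTree_torus`), `recordSiteGeom`, `recordRho`, the window
  labels `recordE` (ROW (W-labels) `rfl` with `lab := id`), `recordSiteOf`, the window size `recordN := sitesPerDir (k+1)` (ROW (N) `rfl`).
* §7 `McGuard F Mc := ∃ c, Mc = L^c` (the record's own cube letter is `τ9.M = L^j`); ROW (Mc) = `rowMc` (lemma file).
* §8 the (1.19) vehicle: `recordAct` (11b's `Sect2.cAct` by `Gᶜ`-valued gauge transformations, in coordinates), `recordToG` (constant rotations), `recordAd`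
  (bondwise `Ad` on chart coordinates, a continuous linear map).
* §9 `thetaFill ∕ recordW ∕ recordΦf` (lens-1's probe bodies VERBATIM: the record's functional `B ↦ 𝓝_{k+1}(exp ρ₈ B)` by tree name); `recordEmb F θ k K` — the
  COORDINATE EMBEDDING `ι`: the 𝔰𝔩₂-coordinates of the tree's series logarithm `MatrixLog.mlog` of the fine-lattice background field `U_{k+1}(W_B)` IN THE ROOTED
  GAUGE (the tree's measurable selector `UkSel`, same contract as the orbit-level `Uk` the merged term of record reads — SAID: «ι C² at 0» is unprovable by
  design for `Uk`, hence the rooted gauge, print's (2.3) p.265; (S1) at the record then carries the gauge invariance of `A_k` inside its content; `mlog` is the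
  series log, read only near the unit); (A2) DEFINITIONAL `recordGk := fderiv ℝ (recordEmb …) 0` on the basis fields (ROW Gk `rfl`), the colour `a : θ.ιβ` a
  PARAMETER (no closed inhabitant of `Fin (suChartDim 2)` in the tree today; ROW (A4) makes it immaterial).
* §11 (v2) `recordK₀ F Mc k := k + 1 + Nat.log F.L Mc` — the VOLUME SHIFT index of CRIT-1's (δ) cure (texts at `recordK₀ F Mc k + n`).
* §12 (v3, CRIT-1 (R-O2)) `recordDom44 F Mc k K X α₂` — print's (4.4) domain `max{|A|, |∇^ξA|, |Δ^ξA|} < α₂` in the chart's units (`‖W‖ < α₂ξ`,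
  first differences `< α₂ξ²`, Laplacian `< α₂ξ³`, `ξ = (F.P K).eta (k+1)`), and the receipt `Chart44DAt` of the repaired 27932‴.
* §13 (v4, director-ym №443 (1)) `recordResponse9Data F θ a Mc k` ∕ `recordResponse9DataFrom F θ a Mc k K₀` — THE RECORD INSTANCE of typer-1's
  `B12FormatPlus.Response9Data` (unshifted ∕ from the base volume `K₀`), and the receipts `Response9At` ∕ `Response9DAt` of 27931‴'s response half.
* §14 (v5, CRIT-1 ‼ R-G (i)) THE CENTRED TWO-VOLUME LAYER `liftSiteCtr ∕ liftBondCtr ∕ liftCubeCtr ∕ OnSeamCtr ∕ recordWrapCtr ∕ recordDomEmbCtr ∕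
  liftCfgIdxCtr ∕ recordCoordProjCtr ∕ recordJXCtr ∕ recordR ∕ recordResponse9Data(From)Ctr ∕ FormatPlus{W,G}AtCtr ∕ Response9(D)AtCtr` — least-absolute-value residues,
  seam = the antipodal layer; THE NAMES THE PORT TEXTS READ (the gate is append-only, so §5's non-centred names stay as variants).
* §15 (v6) `recordRNat := Mc · ⌊q∕2⌋` (the window RADIUS as ℕ) and the radius-guarded receipts `Response9AtCtrR ∕ Response9DAtCtrR` (N-slot := radius).
* §16 (v7, CRIT-1 ‼ RULING (R-J) on porter PT-A's J-CHANNEL) THE TWO-BLOCK `(𝐔, 𝐉)` CHART LAYER — `ChartIdxJ ∕ recordChartDimJ ∕ chartMatU ∕ chartMatJc ∕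
  recordChartJ ∕ recordCXJ ∕ sl2Proj ∕ recordBgUnits ∕ recordCurrent ∕ recordEmbJ ∕ recordGkJ ∕ recordSiteOfJ ∕ recordJXJ ∕ recordAdJ ∕ recordDom44J ∕ recordResponse9Data(From)J ∕
  FormatPlus{G,W}AtJ ∕ Chart44DAtJ ∕ Response9DAtJ ∕ ChartEquivariantAtJ ∕ NoInvariantCovectorAtJ ∕ IotaRowAtJ` — print's (1.9) pair `(U_j, J_j)` through chart and embedding.
* §17 (v8) `recordAStar F a₀ ε₂₉ : (thetaFill F a₀ ε₂₉).ιβ` — the sixteenth name CLOSED (the colour; `0 < suChartDim 2` proved inline) and `recordGkAt` (the parameter-free responses).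
* §10 ELABORATION RECEIPTS `FormatPlusWAt ∕ FormatPlusGAt ∕ Chart44At ∕ ChartEquivariantAt ∕ NoInvariantCovectorAt ∕ IotaRowAt`: the bodies of 27930⁗ (both
  vehicles), 27932″, lens-1's equivariance ∕ semisimplicity rows and 27931‴'s linearisation row AT THESE NAMES — Prop-valued definitions WITH parameters that
  certify the substitution type-checks and ASSERT NOTHING (typer-1 re-issues the texts; CRIT-1 confirms bytes).
The bundle `recordResponseData : ResponseDataOver …` is NOT built in the tree (its carrier lives in lens-1's HOME dictionary): the twelve FIELDS are named
definitions here and the bundle is one structure literal there (NamesAgree' = `⟨rfl, rfl, rfl⟩`).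

THIS FILE IS DEFINITIONS ONLY (statement-form); the `rfl` faces (ROW Gk ∕ (N) ∕ (W-labels)), ROW (Mc), ROW (A3), `decode ∘ encode = id`, the
`spaceI` bridge and the linearity lemmas are the sibling `BalabanUVNodesK0RecordFormatNamesLemmas` (proof kind).

HONEST FRAMING.  Definitions only; NOTHING of Bałaban is asserted, ported or discharged; the texts 27930⁗∕27931‴∕27932″ stay
OPEN and UNSIGNED; K0⁷ `Record13SepCoPHInhabited` NOT closed; NODE O not inhabited (0∕1); COUNT 8∕28 · K 1∕4 UNMOVED; finite `𝕋⁴_{L^K}` at fixed ε — NOT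
continuum ∕ ℝ⁴ ∕ OS; **the Yang–Mills mass gap (Clay) is NOT proved by any of this.**  No `sorry`, `instance`, `notation`; standard axioms.
-/

noncomputable section

open scoped BigOperators Matrix.Norms.L2Operator

namespace Summit.QuantumFields.YangMills.Theorems.K0RecordFormatNames

open Literature.MathematicalPhysics.QuantumFieldTheory.Balaban1983to89
open Literature.MathematicalPhysics.QuantumFieldTheory.Balaban1983to89.Node00
open Literature.MathematicalPhysics.QuantumFieldTheory.Balaban1983to89.T4Continuum (T4Family)
open Literature.MathematicalPhysics.QuantumFieldTheory.Balaban1983to89.TreeLengthTorus (TPt IsTDom tcubeSys)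
open NormedSpace (exp)

variable (F : T4Family)

/-! ## §1  Coordinates of the complex configurations `(𝐔, 𝐉)` on the fine lattice of `T_K` (print's «variables (𝐔, 𝐉)», [I] p.262) -/

/-- Coordinate indices of a pair `(𝐔, 𝐉)` of `M₂(ℂ)`-valued fine-bond functions: (which component and bond) × (matrix entry).
[cite: Balaban1987RG1, (1.9) p.262] -/
abbrev CfgIdx (K : ℕ) : Type := (PBond (F.P K) 0 ⊕ PBond (F.P K) 0) × (Fin 2 × Fin 2)

/-- **`M` — `recordBondCount F K`**: the number of complex coordinates of `(𝐔, 𝐉)` on the fine lattice of `T_K` (`2 · #bonds · 2²`; level-blind: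
the pieces of (1.7) are functions of the fine-lattice configuration). [cite: Balaban1987RG1, (1.9) p.262] -/
def recordBondCount (K : ℕ) : ℕ := Fintype.card (CfgIdx F K)

/-- The enumeration of the coordinate indices. [cite: Balaban1987RG1, (1.9) p.262 (bookkeeping)] -/
def cfgEquiv (K : ℕ) : CfgIdx F K ≃ Fin (recordBondCount F K) := Fintype.equivFin _

/-- Coordinates ↦ the pair `(𝐔, 𝐉)` in 11b's configuration type `Sect2.CPair (F.P K) (MatA 2)`. [cite: Balaban1987RG1, (1.9) p.262] -/
def decodeCfg (K : ℕ) (u : Fin (recordBondCount F K) → ℂ) : Sect2.CPair (F.P K) (MatA 2) :=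
  (fun b => Matrix.of fun i j => u (cfgEquiv F K (Sum.inl b, (i, j))),
   fun b => Matrix.of fun i j => u (cfgEquiv F K (Sum.inr b, (i, j))))

/-- The pair `(𝐔, 𝐉)` ↦ its coordinates. [cite: Balaban1987RG1, (1.9) p.262] -/
def encodeCfg (K : ℕ) (φ : Sect2.CPair (F.P K) (MatA 2)) : Fin (recordBondCount F K) → ℂ :=
  fun n => Sum.elim (fun b => φ.1 b ((cfgEquiv F K).symm n).2.1 ((cfgEquiv F K).symm n).2.2)
    (fun b => φ.2 b ((cfgEquiv F K).symm n).2.1 ((cfgEquiv F K).symm n).2.2) ((cfgEquiv F K).symm n).1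

/-- Chart-input indices: fine bond × 𝔰𝔩₂(ℂ)-colour. [cite: Balaban1987RG1, p.258 (local coordinates), (4.35) p.290] -/
abbrev ChartIdx (K : ℕ) : Type := PBond (F.P K) 0 × Fin 3

/-- **`m` — `recordChartDim F K`**: the number of chart coordinates (three 𝔰𝔩₂(ℂ)-coordinates per fine bond). [cite: Balaban1987RG1, p.258] -/
def recordChartDim (K : ℕ) : ℕ := Fintype.card (ChartIdx F K)

/-- The enumeration of the chart indices. [cite: Balaban1987RG1, p.258 (bookkeeping)] -/
def chartEquiv (K : ℕ) : ChartIdx F K ≃ Fin (recordChartDim F K) := Fintype.equivFin _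

/-- The 𝔰𝔩₂(ℂ) generators `(E₁₂, E₂₁, E₁₁ − E₂₂)`. [cite: Balaban1987RG1, (1.10) p.262 (the algebra 𝔤ᶜ)] -/
def sl2Gen : Fin 3 → MatA 2 := ![!![0, 1; 0, 0], !![0, 0; 1, 0], !![1, 0; 0, -1]]

/-- The 𝔰𝔩₂-coordinates of a `2 × 2` matrix (its traceless part: `Σ_a (sl2Coord A a) • sl2Gen a = A − (tr A ∕ 2)·1`). [cite: Balaban1987RG1, (1.10) p.262] -/
def sl2Coord (A : MatA 2) : Fin 3 → ℂ := ![A 0 1, A 1 0, (A 0 0 - A 1 1) / 2]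

/-- The 𝔰𝔩₂(ℂ) element on the fine bond `b` with chart coordinates `w`. [cite: Balaban1987RG1, p.258 (local coordinates)] -/
def chartMat (K : ℕ) (w : Fin (recordChartDim F K) → ℂ) (b : PBond (F.P K) 0) : MatA 2 :=
  ∑ a : Fin 3, w (chartEquiv F K (b, a)) • sl2Gen a

/-! ## §2  The catalogue `𝐃_{k+1}(T_K)` of record and the coordinates «in X» ([I] p.257, (1.7) p.261) -/

/-- **`recordDomSys F Mc k K := 𝐃_{k+1}(T_K)`** with `d_{k+1}` — 11b's torus catalogue of `Mc`-cube unions at level `k + 1` (lens-1's abbrev, verbatim).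
[cite: Balaban1987RG1, p.257 (class 𝐃_j, d_j)] -/
abbrev recordDomSys (Mc k : ℕ) : ℕ → LocDomainSys := fun K => Sect2.domSys (F.P K) Mc (k + 1)

/-- The fine bonds «in X»: both endpoints in the site set of `X` (11b's (i) «restricted to X»). [cite: Balaban1987RG1, (1.7) p.261 L21] -/
def domBonds (Mc k K : ℕ) (X : (recordDomSys F Mc k K).Dom) : Set (PBond (F.P K) 0) :=
  {b | b.src ∈ Sect2.domSites (F.P K) Mc (k + 1) X ∧ b.tgt ∈ Sect2.domSites (F.P K) Mc (k + 1) X}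

open scoped Classical in
/-- **`coords` — `recordCoords F Mc k K X`**: the coordinate indices of `(𝐔, 𝐉)` on the bonds in `X` (the (1.7) locality set). [cite: Balaban1987RG1, (1.7) p.261] -/
def recordCoords (Mc k K : ℕ) (X : (recordDomSys F Mc k K).Dom) : Finset (Fin (recordBondCount F K)) :=
  Finset.univ.filter fun n => Sum.elim id id ((cfgEquiv F K).symm n).1 ∈ domBonds F Mc k K X

open scoped Classical in
/-- **`cX` — `recordCX F Mc k K X`**: the chart-input indices on the bonds in `X`. [cite: Balaban1987RG1, (1.7) p.261, (4.3) p.281] -/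
def recordCX (Mc k K : ℕ) (X : (recordDomSys F Mc k K).Dom) : Finset (Fin (recordChartDim F K)) :=
  Finset.univ.filter fun i => ((chartEquiv F K).symm i).1 ∈ domBonds F Mc k K X

/-! ## §3  The spaces `U^c_{k+1}(X, α₀, α₁)` OF RECORD in coordinates ([I] (1.11)–(1.16) pp.262–263) -/

/-- The (1.12) constant `O(1)LMB` OF RECORD (the record's §2 numerics `sect2NumericsOfThm1C F.L`, field `cB`). [cite: Balaban1987RG1, (1.12) p.262] -/
def recordCB : ℝ := (sect2NumericsOfThm1C F.L).cB

/-- **`Uc` — `recordUc F Mc k α₀ α₁ K X`**: `U^c_{k+1}(X, α₀, α₁)` OF RECORD read in coordinates — the body of 11b's `Sect2.spaceI` at the `SU(2)` model,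
the record's residual §2 data `RzOfRecord F 2 K` (the UNIT recipe for (1.15)'s backgrounds — `Record12Residuals`, said) and the record's (1.12) constant.
[cite: Balaban1987RG1, (1.11)–(1.16) pp.262–263] -/
def recordUc (Mc k : ℕ) (α₀ α₁ : ℝ) (K : ℕ) (X : (recordDomSys F Mc k K).Dom) : Set (Fin (recordBondCount F K) → ℂ) :=
  decodeCfg F K ⁻¹'
    (Sect2.embedPair '' B12RegularSpaces111.space' (B12RegularSpaces111SpecialUnitary.suModel 2)
      (Sect2.frameI (RzOfRecord F 2 K) Mc (k + 1) (Sect2.domSites (F.P K) Mc (k + 1) X))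
      (B12RegularSpaces111.StepConsts.ofParams (F.P K) (recordCB F) (k + 1)) α₀ α₁)

/-! ## §4  The chart: the coordinatewise EXP-CHART CUT TO `X` ([I] p.258, (4.4) p.281), and (A3) chart input-locality -/

open scoped Classical in
/-- **`χ` — `recordChart F Mc k K X`**: chart coordinates `w ↦` the configuration `(𝐔, 𝐉)` with `𝐔(b) = exp(Σ_a w_{b,a} τ_a)` on the bonds in `X`, `𝐔(b) = 1`
off `X`, `𝐉 = 0`, read in coordinates.  Reads no structural letter. [cite: Balaban1987RG1, p.258 («U_k = exp(iηH′)»), (4.4) p.281] -/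
def recordChart (Mc k K : ℕ) (X : (recordDomSys F Mc k K).Dom) (w : Fin (recordChartDim F K) → ℂ) : Fin (recordBondCount F K) → ℂ :=
  encodeCfg F K (fun b => if b ∈ domBonds F Mc k K X then exp (chartMat F K w b) else 1, fun _ => 0)

/-! ## §5  Two volumes `T_K ⊂ T_{K+1}`: the window lifts, the wrap class, the domain embedding, the coordinate projection, the index lift
(`sitesPerDir_{K+1} j = L · sitesPerDir_K j` in Setup's standing range; [I] (1.21) p.264 «T^{(j+1)} ↗ Z^d») -/

/-- The window lift of sites `ZMod n → ZMod (L n)` (least non-negative residues). [cite: Balaban1987RG1, (1.21) p.264] -/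
def liftSite (K j : ℕ) (x : Site (F.P K) j) : Site (F.P (K + 1)) j := fun μ => ((x μ).val : ZMod _)

/-- The window lift of bonds. [cite: Balaban1987RG1, (1.21) p.264] -/
def liftBond (K j : ℕ) (b : PBond (F.P K) j) : PBond (F.P (K + 1)) j := ⟨liftSite F K j b.src, b.dir⟩

/-- The window lift of cube indices of `𝐃_{k+1}`. [cite: Balaban1987RG1, p.257, (1.21) p.264] -/
def liftCube (Mc k K : ℕ) (c : TPt (F.P K).d (Sect2.domCount (F.P K) Mc (k + 1))) :
    TPt (F.P (K + 1)).d (Sect2.domCount (F.P (K + 1)) Mc (k + 1)) := fun i => ((c i).val : ZMod _)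

/-- A cube index lies ON THE SEAM of the index window. [cite: Balaban1987RG1, (1.21) p.264 (bookkeeping)] -/
def OnSeam {d n : ℕ} (c : TPt d n) : Prop := ∃ i, (c i).val = 0 ∨ (c i).val + 1 = n

open scoped Classical in
/-- **`wrap` — `recordWrap F Mc k K`**: the domains of `𝐃_{k+1}(T_K)` meeting the seam of the window (those NOT carried isometrically into `T_{K+1}`).
[cite: Balaban1987RG1, (1.21) p.264, (1.7) p.261] -/
def recordWrap (Mc k K : ℕ) : Finset (recordDomSys F Mc k K).Dom :=
  Finset.univ.filter fun X => ∃ c ∈ (X.1 : Finset _), OnSeam c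

open scoped Classical in
/-- **`emb` — `recordDomEmb F Mc k K`**: a domain of `T_K` ↦ the lifted cube family in `T_{K+1}` (wall-connected off the seam; on the seam, where the
row never reads it, the default single cube). [cite: Balaban1987RG1, (1.21) p.264, p.257] -/
def recordDomEmb (Mc k K : ℕ) (X : (recordDomSys F Mc k K).Dom) : (recordDomSys F Mc k (K + 1)).Dom :=
  if h : IsTDom ((X.1 : Finset _).image (liftCube F Mc k K)) then ⟨_, h⟩
  else Sect2.cubeDom (F.P (K + 1)) Mc (k + 1) fun _ => 0

/-- The window lift of coordinate indices. [cite: Balaban1987RG1, (1.21) p.264 (bookkeeping)] -/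
def liftCfgIdx (K : ℕ) : CfgIdx F K → CfgIdx F (K + 1) := Prod.map (Sum.map (liftBond F K 0) (liftBond F K 0)) id

/-- **`πc` — `recordCoordProj F K`**: restriction of `T_{K+1}`-coordinates to the (lifted) coordinates of `T_K`. [cite: Balaban1987RG1, (1.21) p.264] -/
def recordCoordProj (K : ℕ) (u' : Fin (recordBondCount F (K + 1)) → ℂ) : Fin (recordBondCount F K) → ℂ :=
  fun n => u' (cfgEquiv F (K + 1) (liftCfgIdx F K ((cfgEquiv F K).symm n)))

/-- **`jX` — `recordJX F K`**: the window lift of chart-input indices. [cite: Balaban1987RG1, (1.21) p.264] -/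
def recordJX (K : ℕ) (i : Fin (recordChartDim F K)) : Fin (recordChartDim F (K + 1)) :=
  chartEquiv F (K + 1) (Prod.map (liftBond F K 0) id ((chartEquiv F K).symm i))

/-! ## §6  The response-side geometry: cube cover, site geometry, label metric, window labels, `siteOf`, window size ([I] p.257, (1.20)–(1.21) p.264) -/

/-- Response labels: unit-lattice bonds `(μ, y)` of `T_K` at level `k + 1` (the sources `δ∕δB_μ(y)`). [cite: Balaban1987RG1, (1.20) p.264] -/
abbrev RespLabel (k K : ℕ) : Type := Fin (F.P K).d × Site (F.P K) (k + 1)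

/-- The torus cube system of `𝐃_{k+1}(T_K)` (the tree's `tcubeSys`; its tree leaf (0.26) is the tree's `hTree_torus`). [cite: Balaban1987RG1, (0.26) pp.257–258] -/
def recordCubeSys (Mc k K : ℕ) : B12TreeDecay.CubeSystem (recordDomSys F Mc k K) :=
  tcubeSys (F.P K).d (Sect2.domCount (F.P K) Mc (k + 1))

/-- **`Cc` — `recordCc F Mc k K`**: the cube cover of `𝐃_{k+1}(T_K)`. [cite: Balaban1987RG1, p.257 (the cubes π_j)] -/
def recordCc (Mc k K : ℕ) : B12.CubeCover (recordDomSys F Mc k K) := (recordCubeSys F Mc k K).toCubeCover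

/-- `ℓ¹` distance on an index torus (least residues both ways, coordinatewise). [cite: Balaban1987RG1, p.257 (bookkeeping)] -/
def idxDist {d n : ℕ} (a b : TPt d n) : ℕ := ∑ i, min (a i - b i).val (b i - a i).val

/-- The `n`-fold block map `T^{(0)} → T^{(n)}` (Setup's `blockOf` iterated). [cite: Balaban1987RG1, (0.3) p.252] -/
def coarsenTo {P : Params} : (n : ℕ) → Site P 0 → Site P n
  | 0 => id
  | n + 1 => fun x => blockOf (coarsenTo n x)

/-- The `Mc`-cube of `T^{(k+1)}` containing a unit-lattice site (index `⌊y_i ∕ Mc⌋` coordinatewise). [cite: Balaban1987RG1, p.257] -/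
def cubeIdxOf (Mc k K : ℕ) (y : Site (F.P K) (k + 1)) : TPt (F.P K).d (Sect2.domCount (F.P K) Mc (k + 1)) :=
  fun i => (((y i).val / Mc : ℕ) : ZMod _)

/-- `dist(y, □)` in unit-lattice units: `Mc ×` the index-torus distance from the cube of `y` to `□`. [cite: Balaban1987RG1, p.257] -/
def recordDistC (Mc k K : ℕ) (l : RespLabel F k K) (c : (recordCc F Mc k K).Cube) : ℝ :=
  (Mc : ℝ) * (idxDist (cubeIdxOf F Mc k K l.2) c : ℝ)

/-- A cube OF `X` nearest to the label `l` (a minimiser of `dist(l, □)` over the cubes of `X`, chosen). [cite: Balaban1987RG1, p.257] -/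
def recordPick (Mc k K : ℕ) (l : RespLabel F k K) (X : (recordDomSys F Mc k K).Dom) : (recordCc F Mc k K).Cube :=
  Classical.choose (Finset.exists_min_image (X.1 : Finset _) (recordDistC F Mc k K l) X.2.1)

/-- **`G` — `recordSiteGeom F Mc k K`**: the site geometry of the unit lattice `T^{(k+1)}` of `T_K` against the cubes and domains of `𝐃_{k+1}`
(`dist(y, X) := dist(y, □)` at a nearest cube `□ ⊂ X`). [cite: Balaban1987RG1, §0 p.257] -/
def recordSiteGeom (Mc k K : ℕ) : B12Decay510.SiteGeometry (recordCc F Mc k K) (RespLabel F k K) where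
  distC := recordDistC F Mc k K
  distD := fun l X => recordDistC F Mc k K l (recordPick F Mc k K l X)
  distC_nonneg := fun _ _ => mul_nonneg (Nat.cast_nonneg _) (Nat.cast_nonneg _)
  distD_nonneg := fun _ _ => mul_nonneg (Nat.cast_nonneg _) (Nat.cast_nonneg _)
  pick := recordPick F Mc k K
  pick_mem := fun l X => (B12TreeDecay.CubeSystem.mem_above _).2
    (Classical.choose_spec (Finset.exists_min_image (X.1 : Finset _) (recordDistC F Mc k K l) X.2.1)).1
  distC_pick_le := fun _ _ => le_rfl

/-- **`ρ` — `recordRho F k K`**: the label metric = the `ℓ¹` torus distance of the source sites in unit-lattice units. [cite: Balaban1987RG1, (1.21) p.264] -/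
def recordRho (k K : ℕ) (l l' : RespLabel F k K) : ℝ := (Site.tdist l.2 l'.2 : ℝ)

/-- **`e` — `recordE F k K μ z`**: the WINDOW LABEL «direction `μ` at the site `−z`» (so that `(e μ 0, e ν z)` is the window's bond pair translated by `−z`;
lens-1's ROW (W-labels) with `lab := id` is `rfl`). [cite: Balaban1987RG1, (1.20)–(1.21) p.264] -/
def recordE (k K : ℕ) (μ : Fin 4) (z : Fin 4 → ℤ) : RespLabel F k K := (Fin.cast (F.P_d K).symm μ, siteOfInt F K (k + 1) (-z))

/-- **`siteOf` — `recordSiteOf F k K i`**: the unit-lattice label over a chart-input index (direction of its fine bond, `(k+1)`-fold block of its source).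
[cite: Balaban1987RG1, (0.3) p.252, (4.35) p.290] -/
def recordSiteOf (k K : ℕ) (i : Fin (recordChartDim F K)) : RespLabel F k K :=
  (((chartEquiv F K).symm i).1.dir, coarsenTo (k + 1) ((chartEquiv F K).symm i).1.src)

/-- **`N` — `recordN F k K := (F.P K).sitesPerDir (k + 1)`**: the record's window is the whole unit torus `T^{(k+1)}` of `T_K` (lens-1's ROW (N) is `rfl`;
cofinal in `K`). [cite: Balaban1987RG1, (1.21) p.264] -/
def recordN (k K : ℕ) : ℕ := (F.P K).sitesPerDir (k + 1)

/-! ## §7  The catalogue guard and ROW (Mc) -/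

/-- **`McGuard F Mc`**: the admissible catalogue letters are the powers of `L` (the record's own cube letter is `τ9.M = L^j`,
`Record13NumericsOfThm1CCMWZB.theta13OfThm1CCMWZB_τ9_M`). [cite: Balaban1987RG1, p.257 (the analysis cube M)] -/
def McGuard (Mc : ℕ) : Prop := ∃ c : ℕ, Mc = F.L ^ c

/-! ## §8  The (1.19) vehicle's names: the `Gᶜ`-valued gauge group in coordinates, the constant rotations, their coordinate action ([I] (1.10) p.262, (4.8) p.283) -/

/-- The (1.10) gauge group read by `U^c` OF RECORD: `Gᶜ = SL(2, ℂ)`-valued gauge transformations of the fine lattice (11b's located reading (ℓ7): the spaces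
are saturated by exactly these). [cite: Balaban1987RG1, (1.10) p.262] -/
def recordGaugeGrp (K : ℕ) : Type :=
  {u : Site (F.P K) 0 → (MatA 2)ˣ // ∀ x, u x ∈ (B12RegularSpaces111SpecialUnitary.suModel 2).Gc}

/-- **`act` — `recordAct F K`**: the (1.10) action `(𝐔, 𝐉)^u = (u₋𝐔u₊⁻¹, u₋𝐉u₋⁻¹)` (11b's `Sect2.cAct`) in coordinates. [cite: Balaban1987RG1, (1.10) p.262] -/
def recordAct (K : ℕ) (u : recordGaugeGrp F K) (c : Fin (recordBondCount F K) → ℂ) : Fin (recordBondCount F K) → ℂ :=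
  encodeCfg F K (Sect2.cAct u.1 (decodeCfg F K c))

/-- **`toG` — `recordToG F K g`**: the CONSTANT gauge transformation of a rotation `g ∈ SU(2)` (through `ιSU`; lands in `Gᶜ` by `suModel_G_le_Gc`).
[cite: Balaban1987RG1, (1.10) p.262, (4.8) p.283 (constant λ)] -/
def recordToG (K : ℕ) (g : SU 2) : recordGaugeGrp F K :=
  ⟨fun _ => ιSU 2 g, fun _ => B12RegularSpaces111SpecialUnitary.suModel_G_le_Gc (ιSU_mem_G 2 g)⟩

/-- The adjoint action of a rotation on chart coordinates, as a function: `w ↦` the 𝔰𝔩₂-coordinates of `g (Σ_a w_{b,a} τ_a) g⁻¹` bondwise.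
[cite: Balaban1987RG1, (4.8) p.283] -/
def recordAdFun (K : ℕ) (g : SU 2) (w : Fin (recordChartDim F K) → ℂ) : Fin (recordChartDim F K) → ℂ :=
  fun i => sl2Coord ((g : MatA 2) * chartMat F K w ((chartEquiv F K).symm i).1 * ((g⁻¹ : SU 2) : MatA 2)) ((chartEquiv F K).symm i).2

/-- **`A` — `recordAd F K g`**: the adjoint action of the constant rotation `g` on chart coordinates, as a continuous linear map (the slot of
`B12FormatPlus.ChartEquivariant` ∕ `NoInvariantCovector`; linearity: `sl2Coord` and `chartMat` are linear, conjugation is linear). [cite: Balaban1987RG1, (4.8) p.283, (4.13)–(4.14) p.284] -/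
def recordAd (K : ℕ) (g : SU 2) : (Fin (recordChartDim F K) → ℂ) →L[ℂ] (Fin (recordChartDim F K) → ℂ) :=
  LinearMap.toContinuousLinearMap
    { toFun := recordAdFun F K g
      map_add' := fun w w' => by
        have hc : ∀ A B : MatA 2, sl2Coord (A + B) = sl2Coord A + sl2Coord B := by
          intro A B; ext a; fin_cases a <;> simp [sl2Coord]; ring
        have hm : ∀ b, chartMat F K (w + w') b = chartMat F K w b + chartMat F K w' b := by
          intro b; simp [chartMat, add_smul, Finset.sum_add_distrib]
        ext i
        simp only [recordAdFun, Pi.add_apply, hm, mul_add, add_mul, hc]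
      map_smul' := fun c w => by
        have hc : ∀ (z : ℂ) (A : MatA 2), sl2Coord (z • A) = z • sl2Coord A := by
          intro z A; ext a; fin_cases a <;> simp [sl2Coord]; ring
        have hm : ∀ b, chartMat F K (c • w) b = c • chartMat F K w b := by
          intro b; simp [chartMat, Finset.smul_sum, smul_smul]
        ext i
        simp only [recordAdFun, Pi.smul_apply, hm, Matrix.mul_smul, Matrix.smul_mul, hc, RingHom.id_apply] }

/-! ## §9  The record functional `Φf` (lens-1's probe, re-homed), the coordinate embedding `ι`, and (A2) the responses `G_k := Dι(0)` -/

/-- The record's Stage-13 parameters with the `Φf`-UNREAD slots filled by literals (lens-1's `θfill`, verbatim): `theta13OfThm1CCMWZB F 2` at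
`j := 0`, `γ := ½`, `εbg := a₀`, `ε₀ := 1`, `B₃ := B₃' := a₁ := 0`, `Efl := logz := 0`. [cite: Balaban1987RG1, Thm 1 p.259, (0.21) p.256 (bookkeeping)] -/
abbrev thetaFill (a₀ ε₂₉ : ℝ) : Stage13Params F 2 :=
  theta13OfThm1CCMWZB F 2 0 (1 / 2) a₀ 1 ε₂₉ 0 0 a₀ 0 (fun _ _ => 0) (fun _ _ => 0)

/-- The record's field space `W K` at level `k` on `T_K`: unit-lattice `Vβ`-valued fields (lens-1's `recordW`, verbatim). [cite: Balaban1987RG1, (1.20) p.264] -/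
abbrev recordW (a₀ ε₂₉ : ℝ) (k K : ℕ) : Type := Fin (F.P K).d → Site (F.P K) (k + 1) → (thetaFill F a₀ ε₂₉).Vβ

/-- **`Φf` — `recordΦf F a₀ ε₂₉ k v`**: the record's functional family `B ↦ 𝓝_{k+1}(exp ρ₈ B)` on `T_K` BY TREE NAME (lens-1's probe body verbatim).
[cite: Balaban1987RG1, (1.6) p.261, (1.20) p.264] -/
def recordΦf (a₀ ε₂₉ : ℝ) (k : ℕ) (v : Fin (k + 1) → ℝ) (K : ℕ) : recordW F a₀ ε₂₉ k K → ℂ :=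
  letI θ := thetaFill F a₀ ε₂₉
  letI := θ.instVβ₁; letI := θ.instVβ₂; letI := θ.instιβ
  fun B => ((B12PolarizationTensor120.expChart
    (mergedTermFamilyMatT F 2 (TβOfRecord₁₃ F 2) (chiβOfRecord₁₃ F 2 θ) θ.εbg k v K) θ.ρ8 B : ℝ) : ℂ)

variable (θ : Stage13Params F 2)

/-- The unit-lattice `SU(2)` configuration charted by `B`: `W_B(b) = exp(ρ₈ B(b))` read through `suOfMat` (the argument of `𝓝_{k+1}` inside `recordΦf`).
[cite: Balaban1987RG1, p.264 (before (1.20))] -/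
def unitField (k K : ℕ) (B : Fin (F.P K).d → Site (F.P K) (k + 1) → θ.Vβ) : GaugeField (F.P K) (k + 1) (SU 2) :=
  letI := θ.instVβ₁; letI := θ.instVβ₂
  readField F 2 (suOfMat 2) fun μ x => exp (θ.ρ8 (B μ x))

/-- **The fine-lattice BACKGROUND FIELD of the charted configuration, IN THE ROOTED GAUGE**: `U_{k+1}(W_B)` through the tree's measurable rooted-gauge
selector `UkSel` (regularity radius `θ.εbg`; same contract as the orbit-level `Uk` read by the merged term of record — SAID). [cite: Balaban1987RG1, (0.21) p.256, (1.1) p.260, (2.3) p.265; Balaban1985Variational, Thm 1 p.279] -/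
def recordBgField (k K : ℕ) (B : Fin (F.P K).d → Site (F.P K) (k + 1) → θ.Vβ) : GaugeField (F.P K) 0 (SU 2) :=
  UkSel F 2 K (k + 1) θ.εbg (unitField F θ k K B)

/-- **`ι` — `recordEmb F θ k K`**: the COORDINATE EMBEDDING `B ↦` the 𝔰𝔩₂-coordinates of `log U_{k+1}(W_B)` bondwise (the tree's series logarithm `mlog`;
print's `H′` in «U_k = exp(iηH′)»).  Instantiate `θ := thetaFill F a₀ ε₂₉`; reads `θ.εbg`, `θ.ρ8` only. [cite: Balaban1987RG1, p.258, (4.35) p.290] -/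
def recordEmb (k K : ℕ) (B : Fin (F.P K).d → Site (F.P K) (k + 1) → θ.Vβ) : Fin (recordChartDim F K) → ℂ :=
  fun i => sl2Coord (MatrixLog.mlog ((recordBgField F θ k K B ((chartEquiv F K).symm i).1 : SU 2) : MatA 2)) ((chartEquiv F K).symm i).2

/-- **(A2) DEFINITIONAL — `G_k := Dι(0)` on the basis fields**: `recordGk F θ k K a (μ, y) i = ∂ ι_i ∕ ∂ B^a_μ(y) (0)` at the colour `a` (a PARAMETER; ROW (A4)
makes the choice immaterial).  Lens-1's ROW Gk with `lab := id` is `rfl` (`recordGk_eq`). [cite: Balaban1987RG1, (4.35) p.290; Balaban1985Variational, Prop. 9] -/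
def recordGk (k K : ℕ) (a : θ.ιβ) (l : RespLabel F k K) (i : Fin (recordChartDim F K)) : ℂ :=
  letI := θ.instVβ₁; letI := θ.instVβ₂; letI := θ.instιβ
  fderiv ℝ (recordEmb F θ k K) 0 (Pi.single l.1 (Pi.single l.2 (θ.bV a))) i

/-! ## §10  ELABORATION RECEIPTS: the bodies of the three port texts AT THESE NAMES (Prop-valued definitions with parameters; they ASSERT NOTHING and are
not item texts — typer-1 re-issues the texts, CRIT-1 confirms bytes; these certify that the substitution type-checks) -/

/-- 27930⁗ (Ward vehicle) body at the names: `FormatPlusW` over `𝐃_{k+1}(T_·)`, the record's coordinates, spaces, chart, functional, embedding and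
two-volume data. [cite: Balaban1987RG1, (1.6)–(1.7) p.261, (1.18) p.263, (1.21) p.264, (4.14) p.284] -/
def FormatPlusWAt (Mc k : ℕ) (a₀ ε₂₉ α₀ α₁ E₀ κ : ℝ) (v : Fin (k + 1) → ℝ) : Prop :=
  letI θ := thetaFill F a₀ ε₂₉
  letI := θ.instVβ₁; letI := θ.instVβ₂; letI := θ.instιβ
  B12FormatPlus.FormatPlusW (recordDomSys F Mc k) (recordBondCount F) (recordUc F Mc k α₀ α₁) (recordCoords F Mc k) (recordChartDim F)
    (recordChart F Mc k) (recordΦf F a₀ ε₂₉ k v) (recordEmb F θ k) (recordWrap F Mc k) (recordDomEmb F Mc k)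
    (fun K _ => recordCoordProj F K) E₀ κ

/-- 27930⁗ ((1.19) vehicle) body at the names: `FormatPlusG` with the NAMED action `recordAct`. [cite: Balaban1987RG1, (1.6)–(1.7) p.261, (1.18)–(1.19) p.263, (1.21) p.264] -/
def FormatPlusGAt (Mc k : ℕ) (a₀ ε₂₉ α₀ α₁ E₀ κ : ℝ) (v : Fin (k + 1) → ℝ) : Prop :=
  letI θ := thetaFill F a₀ ε₂₉
  letI := θ.instVβ₁; letI := θ.instVβ₂; letI := θ.instιβ
  B12FormatPlus.FormatPlusG (recordDomSys F Mc k) (recordBondCount F) (recordAct F) (recordUc F Mc k α₀ α₁) (recordCoords F Mc k)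
    (recordChartDim F) (recordChart F Mc k) (recordΦf F a₀ ε₂₉ k v) (recordEmb F θ k) (recordWrap F Mc k) (recordDomEmb F Mc k)
    (fun K _ => recordCoordProj F K) E₀ κ

/-- 27932″ (O2′) body at the names: `Chart44` for the record's spaces and chart. [cite: Balaban1987RG1, (3.36)–(3.54) pp.277–280, (4.4) p.281] -/
def Chart44At (Mc k : ℕ) (α₀ α₁ α₂ : ℝ) : Prop :=
  B12FormatPlus.Chart44 (recordDomSys F Mc k) (recordBondCount F) (recordUc F Mc k α₀ α₁) (recordChartDim F) (recordChart F Mc k) α₂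

/-- lens-1's ROW (chart equivariance) at the names: `ChartEquivariant recordToG recordAct (recordChart …) recordAd`. [cite: Balaban1987RG1, (1.10) p.262, (4.8) p.283] -/
def ChartEquivariantAt (Mc k : ℕ) : Prop :=
  B12FormatPlus.ChartEquivariant (recordToG F) (recordAct F) (recordChart F Mc k) (recordAd F)

/-- lens-1's ROW (semisimplicity by name) at the names: no invariant covector for the adjoint action on chart coordinates. [cite: Balaban1987RG1, (4.13)–(4.14) p.284] -/
def NoInvariantCovectorAt (K : ℕ) : Prop :=
  B12FormatPlus.NoInvariantCovector (recordAd F K)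

/-- 27931‴'s (A2) linearisation row at the names: the coordinate embedding is `C²` at `0` and vanishes there. [cite: Balaban1987RG1, (4.35) p.290; Balaban1985Variational, Prop. 9] -/
def IotaRowAt (k K : ℕ) : Prop :=
  letI := θ.instVβ₁; letI := θ.instVβ₂
  ContDiffAt ℝ 2 (recordEmb F θ k K) 0 ∧ recordEmb F θ k K 0 = 0

/-! ## §11  (v2, CRIT-1 l.3621 (δ) ∕ DEF-1 choice nodeO STATUS 22:2xZ) The VOLUME SHIFT: the least exactly-tiled volume index `recordK₀` -/

/-- **`recordK₀ F Mc k`** — the volume index from which the `Mc`-cubes of `T^{(k+1)}` tile `T_K` EXACTLY (for an admissible letter `Mc = L^c`: every `K ≥ k + 1 + c`,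
since `L^{k+1+c} ∣ 2L^{m+K}`; lemma file: `pow_mul_dvd_sitesPerDir`, `domCount_mul_side_eq`).  The port texts instantiate every `K`-family at `recordK₀ F Mc k + n`
(the shift on the LEFT, so that `recordK₀ … + (n + 1)` is `(recordK₀ … + n) + 1` definitionally and the `emb ∕ πc ∕ jX` slots need no cast); cofinal in `K`, so the
(1.21) limit is untouched. [cite: Balaban1987RG1, p.257 (the cubes π_j tile the torus), (1.21) p.264] -/
def recordK₀ (Mc k : ℕ) : ℕ := k + 1 + Nat.log F.L Mc

/-! ## §12  (v3, CRIT-1 ‼ l.3637 (R-O2)) PRINT's (4.4) ANALYTICITY DOMAIN IN THE CHART's UNITS: `recordDom44`, and the receipt of the repaired 27932‴ -/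

/-- **`recordDom44 F Mc k K X α₂`** — print's (4.4) domain «max{|A|_X, |∇^ξ A|_X, |Δ^ξ A|_X} < α₂» for `U = exp(iξA)`, `ξ = L^{−(k+1)}`
(`(F.P K).eta (k + 1)`), READ IN THE CHART's UNITS `U = exp W`, `W = chartMat F K w` (so `W = iξA`): on the bonds in `X`, `‖W(b)‖ < α₂ ξ`; on neighbouring
bonds in `X`, `‖W(b + e_μ) − W(b)‖ < α₂ ξ²`; where all `2d` neighbours lie in `X`, the lattice Laplacian `‖Σ_μ (W(b + e_μ) − 2W(b) + W(b − e_μ))‖ < α₂ ξ³`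
(plain differences: (4.4) is the flat case `U = 1, J = 0`).  A CONVEX, BALANCED, OPEN set containing `0` for `α₂ > 0` (lemma file), thin in the rough
directions and `O(1)` in the smooth ones — the currency in which print's α₂ is uniform in `k` (CRIT-1 (R-O2); the polydisc `ball 0 α₂` of (O2′) is not).
[cite: Balaban1987RG1, (4.4) p.281, (3.36)–(3.54) pp.277–280] -/
def recordDom44 (Mc k K : ℕ) (X : (recordDomSys F Mc k K).Dom) (α₂ : ℝ) : Set (Fin (recordChartDim F K) → ℂ) :=
  {w | (∀ b ∈ domBonds F Mc k K X, ‖chartMat F K w b‖ < α₂ * (F.P K).eta (k + 1)) ∧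
    (∀ b ∈ domBonds F Mc k K X, ∀ μ : Fin (F.P K).d, (⟨b.src.shift μ, b.dir⟩ : PBond (F.P K) 0) ∈ domBonds F Mc k K X →
      ‖chartMat F K w ⟨b.src.shift μ, b.dir⟩ - chartMat F K w b‖ < α₂ * (F.P K).eta (k + 1) ^ 2) ∧
    (∀ b ∈ domBonds F Mc k K X,
      (∀ μ : Fin (F.P K).d, (⟨b.src.shift μ, b.dir⟩ : PBond (F.P K) 0) ∈ domBonds F Mc k K X ∧
        (⟨b.src.unshift μ, b.dir⟩ : PBond (F.P K) 0) ∈ domBonds F Mc k K X) →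
      ‖∑ μ : Fin (F.P K).d, (chartMat F K w ⟨b.src.shift μ, b.dir⟩ - (2 : ℂ) • chartMat F K w b + chartMat F K w ⟨b.src.unshift μ, b.dir⟩)‖ <
        α₂ * (F.P K).eta (k + 1) ^ 3)}

/-- RECEIPT of the repaired 27932‴ body at the names (CRIT-1 (R-O2) mould `Chart44D`, to be typed in `B12FormatPlus` v5; until then this is its body verbatim):
the chart is analytic on the named domain, which is convex, balanced, open, contains `0`, and is carried into `U^c` — Prop-valued, parameters explicit, asserts nothing.
[cite: Balaban1987RG1, (4.4) p.281, (1.11)–(1.16) p.262] -/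
def Chart44DAt (Mc k : ℕ) (α₀ α₁ α₂ : ℝ) : Prop :=
  ∀ (K : ℕ) (X : (recordDomSys F Mc k K).Dom),
    Convex ℝ (recordDom44 F Mc k K X α₂) ∧ Balanced ℂ (recordDom44 F Mc k K X α₂) ∧ IsOpen (recordDom44 F Mc k K X α₂) ∧
      (0 : Fin (recordChartDim F K) → ℂ) ∈ recordDom44 F Mc k K X α₂ ∧
      AnalyticOnNhd ℂ (recordChart F Mc k K X) (recordDom44 F Mc k K X α₂) ∧
      Set.MapsTo (recordChart F Mc k K X) (recordDom44 F Mc k K X α₂) (recordUc F Mc k α₀ α₁ K X)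

/-! ## §13  (v4, director-ym №443 (1) route (ii)) THE RECORD INSTANCE of typer-1's generic response carrier `B12FormatPlus.Response9Data` (v4 ✓p792912),
unshifted and FROM A BASE VOLUME `K₀` (the (δ) shift), and the receipts of 27931‴'s response half over `Response9` ∕ `Response9D` (v5 ✓p793008) -/

/-- **`recordResponse9Data F θ a Mc k`** — THE RECORD's RESPONSE DATA as ONE structure literal over the twelve named fields (field order `Cc Λ G ρ e cX siteOf Gk wrap
emb jX πc` = typer-1's `Response9Data` = lens-1's HOME `ResponseDataOver`, so NamesAgree′ is `⟨rfl, rfl, rfl⟩`): cube cover, unit-lattice labels, site geometry, label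
metric, window labels, chart inputs «in X», `siteOf`, the responses `G_k := Dι(0)` at the colour `a`, wrap class, domain embedding, index lift, coordinate projection.
Instantiate `θ := thetaFill F a₀ ε₂₉`. [cite: Balaban1985Variational, Prop. 9; Balaban1987RG1, (1.7) p.261, (1.21) p.264, (4.35) p.290] -/
def recordResponse9Data (a : θ.ιβ) (Mc k : ℕ) :
    B12FormatPlus.Response9Data (recordDomSys F Mc k) (recordBondCount F) (recordChartDim F) 4 where
  Cc := recordCc F Mc k
  Λ := fun K => RespLabel F k K
  G := recordSiteGeom F Mc k
  ρ := fun K => recordRho F k K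
  e := fun K => recordE F k K
  cX := recordCX F Mc k
  siteOf := fun K => recordSiteOf F k K
  Gk := fun K => recordGk F θ k K a
  wrap := recordWrap F Mc k
  emb := recordDomEmb F Mc k
  jX := fun K _ => recordJX F K
  πc := fun K _ => recordCoordProj F K

/-- **`recordResponse9DataFrom F θ a Mc k K₀`** — the same record data READ FROM THE BASE VOLUME `K₀` ON (member `n` = volume `K₀ + n`; `K₀` on the left so that
member `n + 1` is volume `(K₀ + n) + 1` definitionally and `emb ∕ jX ∕ πc` need no cast).  The port texts take `K₀ := recordK₀ F Mc k`.
[cite: Balaban1985Variational, Prop. 9; Balaban1987RG1, (1.21) p.264] -/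
def recordResponse9DataFrom (a : θ.ιβ) (Mc k K₀ : ℕ) :
    B12FormatPlus.Response9Data (fun n => recordDomSys F Mc k (K₀ + n)) (fun n => recordBondCount F (K₀ + n)) (fun n => recordChartDim F (K₀ + n)) 4 where
  Cc := fun n => recordCc F Mc k (K₀ + n)
  Λ := fun n => RespLabel F k (K₀ + n)
  G := fun n => recordSiteGeom F Mc k (K₀ + n)
  ρ := fun n => recordRho F k (K₀ + n)
  e := fun n => recordE F k (K₀ + n)
  cX := fun n => recordCX F Mc k (K₀ + n)
  siteOf := fun n => recordSiteOf F k (K₀ + n)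
  Gk := fun n => recordGk F θ k (K₀ + n) a
  wrap := fun n => recordWrap F Mc k (K₀ + n)
  emb := fun n => recordDomEmb F Mc k (K₀ + n)
  jX := fun n _ => recordJX F (K₀ + n)
  πc := fun n _ => recordCoordProj F (K₀ + n)

/-- RECEIPT: 27931‴'s response half in the SUP-norm carrier (`B12FormatPlus.Response9`, v4) at the record's shifted data — Prop-valued, asserts nothing.
[cite: Balaban1985Variational, Prop. 9; Balaban1987RG1, (1.21) p.264, (4.35) p.290] -/
def Response9At (a : θ.ιβ) (Mc k K₀ : ℕ) (C₉ δ₀ w : ℝ) : Prop :=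
  B12FormatPlus.Response9 (recordResponse9DataFrom F θ a Mc k K₀) (fun n => recordChart F Mc k (K₀ + n)) (fun n => recordN F k (K₀ + n)) C₉ δ₀ w

/-- RECEIPT: 27931‴'s response half in the GAUGE norm of the named (4.4) domain (`B12FormatPlus.Response9D`, v5; CRIT-1 (R-O2) (5)) at the record's shifted data —
Prop-valued, asserts nothing. [cite: Balaban1985Variational, Prop. 9; Balaban1987RG1, (4.4) p.281, (1.21) p.264, (4.35) p.290] -/
def Response9DAt (a : θ.ιβ) (Mc k K₀ : ℕ) (α₂ C₉ δ₀ : ℝ) : Prop :=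
  B12FormatPlus.Response9D (recordResponse9DataFrom F θ a Mc k K₀) (fun n => recordChart F Mc k (K₀ + n)) (fun n => recordN F k (K₀ + n))
    (fun n X => recordDom44 F Mc k (K₀ + n) X α₂) C₉ δ₀

/-! ## §14  (v5, CRIT-1 ‼ nodeO STATUS 22:36Z, R-G (i)) THE CENTRED TWO-VOLUME LAYER — the `…Ctr` names the port texts read from now on.
The v1 lifts of §5 take least NON-NEGATIVE residues, which puts the window's base cube `0` ON their seam; the gate forbids re-cutting landed bodies
(append-only), so the CENTRED lifts — least-ABSOLUTE-value residues `ZMod.valMinAbs ∈ (−n∕2, n∕2]`, seam = the antipodal layer `⌊q∕2⌋`, at index distance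
`⌊q∕2⌋` from the base cube — come under NEW names with the SAME types; §5 ∕ §13 ∕ §10's `recordWrap ∕ recordDomEmb ∕ recordCoordProj ∕ recordJX ∕
recordResponse9Data(From) ∕ FormatPlus{W,G}At ∕ Response9(D)At` stay as the non-centred variants and are superseded FOR THE TEXTS by the `…Ctr` twins below
(27930⁵'s three tokens `recordWrap ∕ recordDomEmb ∕ recordCoordProj` ↦ `…Ctr`: a re-signature).  On the window `2|z_i| < N` the centred lift carries the
label `e K μ z` of `T_K` to the label `e (K+1) μ z` of `T_{K+1}` — the coherence 27931's two-volume comparison row needs. -/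

/-- The CENTRED window lift of sites `ZMod n → ZMod (L n)`: least-absolute-value residues. [cite: Balaban1987RG1, (1.21) p.264] -/
def liftSiteCtr (K j : ℕ) (x : Site (F.P K) j) : Site (F.P (K + 1)) j := fun μ => (((x μ).valMinAbs : ℤ) : ZMod _)

/-- The centred window lift of bonds. [cite: Balaban1987RG1, (1.21) p.264] -/
def liftBondCtr (K j : ℕ) (b : PBond (F.P K) j) : PBond (F.P (K + 1)) j := ⟨liftSiteCtr F K j b.src, b.dir⟩

/-- The CENTRED window lift of cube indices of `𝐃_{k+1}` (least-absolute-value residues); off the antipodal layer it is consistent with `liftSiteCtr` cube by cube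
and preserves wall-adjacency. [cite: Balaban1987RG1, p.257, (1.21) p.264] -/
def liftCubeCtr (Mc k K : ℕ) (c : TPt (F.P K).d (Sect2.domCount (F.P K) Mc (k + 1))) :
    TPt (F.P (K + 1)).d (Sect2.domCount (F.P (K + 1)) Mc (k + 1)) := fun i => (((c i).valMinAbs : ℤ) : ZMod _)

/-- A cube index lies ON THE SEAM of the CENTRED window: some coordinate is the antipodal index value `⌊n∕2⌋` (the maximum of `ZMod.valMinAbs`, the layer
through which the centred lift jumps). [cite: Balaban1987RG1, (1.21) p.264 (bookkeeping)] -/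
def OnSeamCtr {d n : ℕ} (c : TPt d n) : Prop := ∃ i, (c i).valMinAbs = ((n / 2 : ℕ) : ℤ)

open scoped Classical in
/-- **`recordWrapCtr F Mc k K`** — the wrap class of the CENTRED window: domains of `𝐃_{k+1}(T_K)` meeting the antipodal seam layer (every such domain lies at
index distance `≥ ⌊q∕2⌋` minus its own extent from the base cube; cf. `recordR`). [cite: Balaban1987RG1, (1.21) p.264, (1.7) p.261] -/
def recordWrapCtr (Mc k K : ℕ) : Finset (recordDomSys F Mc k K).Dom :=
  Finset.univ.filter fun X => ∃ c ∈ (X.1 : Finset _), OnSeamCtr c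

open scoped Classical in
/-- **`recordDomEmbCtr F Mc k K`** — the CENTRED domain embedding: the centred lift of the cube family (wall-connected off the seam; default single cube on it,
where no row reads it). [cite: Balaban1987RG1, (1.21) p.264, p.257] -/
def recordDomEmbCtr (Mc k K : ℕ) (X : (recordDomSys F Mc k K).Dom) : (recordDomSys F Mc k (K + 1)).Dom :=
  if h : IsTDom ((X.1 : Finset _).image (liftCubeCtr F Mc k K)) then ⟨_, h⟩
  else Sect2.cubeDom (F.P (K + 1)) Mc (k + 1) fun _ => 0

/-- The centred window lift of coordinate indices. [cite: Balaban1987RG1, (1.21) p.264 (bookkeeping)] -/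
def liftCfgIdxCtr (K : ℕ) : CfgIdx F K → CfgIdx F (K + 1) := Prod.map (Sum.map (liftBondCtr F K 0) (liftBondCtr F K 0)) id

/-- **`recordCoordProjCtr F K`** — restriction of `T_{K+1}`-coordinates to the CENTRED-lifted coordinates of `T_K`. [cite: Balaban1987RG1, (1.21) p.264] -/
def recordCoordProjCtr (K : ℕ) (u' : Fin (recordBondCount F (K + 1)) → ℂ) : Fin (recordBondCount F K) → ℂ :=
  fun n => u' (cfgEquiv F (K + 1) (liftCfgIdxCtr F K ((cfgEquiv F K).symm n)))

/-- **`recordJXCtr F K`** — the CENTRED window lift of chart-input indices. [cite: Balaban1987RG1, (1.21) p.264] -/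
def recordJXCtr (K : ℕ) (i : Fin (recordChartDim F K)) : Fin (recordChartDim F (K + 1)) :=
  chartEquiv F (K + 1) (Prod.map (liftBondCtr F K 0) id ((chartEquiv F K).symm i))

/-- **`recordR F Mc k K`** — the COMPARISON RADIUS: the distance, in the units of `recordDistC` (unit-lattice sites = `Mc` × cube-index steps), from the base
cube `0` to the seam layer of the centred window, `Mc · ⌊q∕2⌋` with `q := Sect2.domCount (F.P K) Mc (k + 1)`; every seam cube `c` has
`recordDistC … (recordE … μ 0) c ≥ recordR`, and `recordN F k K ∕ 4 ≤ recordR F Mc k K` once `q ≥ 2` on the exactly-tiled range (`N = q · Mc`).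
[cite: Balaban1987RG1, (1.21) p.264] -/
def recordR (Mc k K : ℕ) : ℝ := (Mc : ℝ) * ((Sect2.domCount (F.P K) Mc (k + 1) / 2 : ℕ) : ℝ)

/-- **`recordResponse9DataCtr F θ a Mc k`** — the record response data with the CENTRED two-volume layer (`wrap ∕ emb ∕ jX ∕ πc` := the `…Ctr` names; all
other fields as in `recordResponse9Data`). [cite: Balaban1985Variational, Prop. 9; Balaban1987RG1, (1.7) p.261, (1.21) p.264, (4.35) p.290] -/
def recordResponse9DataCtr (a : θ.ιβ) (Mc k : ℕ) :
    B12FormatPlus.Response9Data (recordDomSys F Mc k) (recordBondCount F) (recordChartDim F) 4 where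
  Cc := recordCc F Mc k
  Λ := fun K => RespLabel F k K
  G := recordSiteGeom F Mc k
  ρ := fun K => recordRho F k K
  e := fun K => recordE F k K
  cX := recordCX F Mc k
  siteOf := fun K => recordSiteOf F k K
  Gk := fun K => recordGk F θ k K a
  wrap := recordWrapCtr F Mc k
  emb := recordDomEmbCtr F Mc k
  jX := fun K _ => recordJXCtr F K
  πc := fun K _ => recordCoordProjCtr F K

/-- **`recordResponse9DataFromCtr F θ a Mc k K₀`** — the same, read from the base volume `K₀` on (member `n` = volume `K₀ + n`). The port texts take
`K₀ := recordK₀ F Mc k`. [cite: Balaban1985Variational, Prop. 9; Balaban1987RG1, (1.21) p.264] -/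
def recordResponse9DataFromCtr (a : θ.ιβ) (Mc k K₀ : ℕ) :
    B12FormatPlus.Response9Data (fun n => recordDomSys F Mc k (K₀ + n)) (fun n => recordBondCount F (K₀ + n)) (fun n => recordChartDim F (K₀ + n)) 4 where
  Cc := fun n => recordCc F Mc k (K₀ + n)
  Λ := fun n => RespLabel F k (K₀ + n)
  G := fun n => recordSiteGeom F Mc k (K₀ + n)
  ρ := fun n => recordRho F k (K₀ + n)
  e := fun n => recordE F k (K₀ + n)
  cX := fun n => recordCX F Mc k (K₀ + n)
  siteOf := fun n => recordSiteOf F k (K₀ + n)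
  Gk := fun n => recordGk F θ k (K₀ + n) a
  wrap := fun n => recordWrapCtr F Mc k (K₀ + n)
  emb := fun n => recordDomEmbCtr F Mc k (K₀ + n)
  jX := fun n _ => recordJXCtr F (K₀ + n)
  πc := fun n _ => recordCoordProjCtr F (K₀ + n)

/-- RECEIPT (centred): 27930's Ward-vehicle body with the `…Ctr` two-volume layer. [cite: Balaban1987RG1, (1.6)–(1.7) p.261, (1.18) p.263, (1.21) p.264, (4.14) p.284] -/
def FormatPlusWAtCtr (Mc k : ℕ) (a₀ ε₂₉ α₀ α₁ E₀ κ : ℝ) (v : Fin (k + 1) → ℝ) : Prop :=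
  letI θ := thetaFill F a₀ ε₂₉
  letI := θ.instVβ₁; letI := θ.instVβ₂; letI := θ.instιβ
  B12FormatPlus.FormatPlusW (recordDomSys F Mc k) (recordBondCount F) (recordUc F Mc k α₀ α₁) (recordCoords F Mc k) (recordChartDim F)
    (recordChart F Mc k) (recordΦf F a₀ ε₂₉ k v) (recordEmb F θ k) (recordWrapCtr F Mc k) (recordDomEmbCtr F Mc k)
    (fun K _ => recordCoordProjCtr F K) E₀ κ

/-- RECEIPT (centred): 27930⁵'s (1.19)-vehicle body with the `…Ctr` two-volume layer. [cite: Balaban1987RG1, (1.6)–(1.7) p.261, (1.18)–(1.19) p.263, (1.21) p.264] -/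
def FormatPlusGAtCtr (Mc k : ℕ) (a₀ ε₂₉ α₀ α₁ E₀ κ : ℝ) (v : Fin (k + 1) → ℝ) : Prop :=
  letI θ := thetaFill F a₀ ε₂₉
  letI := θ.instVβ₁; letI := θ.instVβ₂; letI := θ.instιβ
  B12FormatPlus.FormatPlusG (recordDomSys F Mc k) (recordBondCount F) (recordAct F) (recordUc F Mc k α₀ α₁) (recordCoords F Mc k)
    (recordChartDim F) (recordChart F Mc k) (recordΦf F a₀ ε₂₉ k v) (recordEmb F θ k) (recordWrapCtr F Mc k) (recordDomEmbCtr F Mc k)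
    (fun K _ => recordCoordProjCtr F K) E₀ κ

/-- RECEIPT (centred): 27931's response half, sup-norm carrier, from the base volume `K₀`. [cite: Balaban1985Variational, Prop. 9; Balaban1987RG1, (1.21) p.264, (4.35) p.290] -/
def Response9AtCtr (a : θ.ιβ) (Mc k K₀ : ℕ) (C₉ δ₀ w : ℝ) : Prop :=
  B12FormatPlus.Response9 (recordResponse9DataFromCtr F θ a Mc k K₀) (fun n => recordChart F Mc k (K₀ + n)) (fun n => recordN F k (K₀ + n)) C₉ δ₀ w

/-- RECEIPT (centred): 27931's response half, gauge norm of the named (4.4) domain, from the base volume `K₀`. [cite: Balaban1985Variational, Prop. 9; Balaban1987RG1, (4.4) p.281, (1.21) p.264] -/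
def Response9DAtCtr (a : θ.ιβ) (Mc k K₀ : ℕ) (α₂ C₉ δ₀ : ℝ) : Prop :=
  B12FormatPlus.Response9D (recordResponse9DataFromCtr F θ a Mc k K₀) (fun n => recordChart F Mc k (K₀ + n)) (fun n => recordN F k (K₀ + n))
    (fun n X => recordDom44 F Mc k (K₀ + n) X α₂) C₉ δ₀

/-! ## §15  (v6, CRIT-1 ‼ nodeO STATUS 22:41:59Z) THE WINDOW RADIUS IN THE N-SLOT: `recordRNat` and the radius-guarded response receipts -/

/-- **`recordRNat F Mc k K : ℕ := Mc · ⌊q∕2⌋`** — the comparison radius as a natural number (`recordR = (recordRNat : ℝ)`): the N-slot of the two-volume response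
row (R4ᴰ) must admit only labels `z` with `2|z_i| < recordRNat` (inside the centred window, away from the cut), not every label of the torus (`recordN`), else
the row is false at seam-adjacent domains for large `K` (CRIT-1's counter-geometry). [cite: Balaban1987RG1, (1.21) p.264] -/
def recordRNat (Mc k K : ℕ) : ℕ := Mc * (Sect2.domCount (F.P K) Mc (k + 1) / 2)

/-- RECEIPT (centred, RADIUS-guarded): 27931's response half, sup-norm carrier, window guard at `recordRNat`. [cite: Balaban1985Variational, Prop. 9; Balaban1987RG1, (1.21) p.264] -/
def Response9AtCtrR (a : θ.ιβ) (Mc k K₀ : ℕ) (C₉ δ₀ w : ℝ) : Prop :=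
  B12FormatPlus.Response9 (recordResponse9DataFromCtr F θ a Mc k K₀) (fun n => recordChart F Mc k (K₀ + n)) (fun n => recordRNat F Mc k (K₀ + n)) C₉ δ₀ w

/-- RECEIPT (centred, RADIUS-guarded): 27931's response half in the gauge norm of the named (4.4) domain, window guard at `recordRNat` — the shape 27931 reads.
[cite: Balaban1985Variational, Prop. 9; Balaban1987RG1, (4.4) p.281, (1.21) p.264] -/
def Response9DAtCtrR (a : θ.ιβ) (Mc k K₀ : ℕ) (α₂ C₉ δ₀ : ℝ) : Prop :=
  B12FormatPlus.Response9D (recordResponse9DataFromCtr F θ a Mc k K₀) (fun n => recordChart F Mc k (K₀ + n)) (fun n => recordRNat F Mc k (K₀ + n))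
    (fun n X => recordDom44 F Mc k (K₀ + n) X α₂) C₉ δ₀

/-! ## §16  (v7, CRIT-1 ‼ RULING nodeO STATUS 22:51Z on porter PT-A's «J-CHANNEL», repair (R-J)) THE TWO-BLOCK `(𝐔, 𝐉)` CHART LAYER — the `…J` names.
Print [I] (1.9) p.261: «there are functions E^{(j)}(X, g, 𝐔, 𝐉), analytic on a space of regular, complex configurations 𝐔, 𝐉, such that
E^{(j)}(X, g, U_j) = E^{(j)}(X, g, U_j, J_j)», `J_j = D^{ξ*} ξ⁻² π Im ∂U_j` the CURRENT (1.8) (tree: `B12Eq18Current.current`).  The v1 chart fed `𝐉 := 0` and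
the v1 embedding carried `log U` only — a J-FREE representation, stronger than Thm 3 and not print's.  Here the chart carries a `𝐉`-BLOCK per fine bond and the
embedding carries the current of the background field, so that `χ_X ∘ ι = (U_{k+1}|_X ∪ 1, J(U_{k+1})|_X ∪ 0)` = (1.9)'s pair CUT TO `X`, verbatim; the gauge group
acts on the `𝐉`-block by `Ad` ((1.10) `R(u)𝐉`); the (4.4)∕(3.14) domain keeps the three SCALED `𝐔`-clauses and adds the CONSTANT-radius `𝐉`-clause (print's (1.14)
«|𝐉| < γ₀», no ξ-power).  Two-volume data = the CENTRED layer of §14; window radius = §15's `recordRNat`.  New names per the append-only rule; §1–§15 stay. -/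

/-- Chart-input indices of the two-block chart: fine bond × (𝔰𝔩₂-colour of the `𝐔`-block ⊕ 𝔰𝔩₂-colour of the `𝐉`-block). [cite: Balaban1987RG1, (1.9) p.261, (4.4) p.281] -/
abbrev ChartIdxJ (K : ℕ) : Type := PBond (F.P K) 0 × (Fin 3 ⊕ Fin 3)

/-- **`m` (two-block) — `recordChartDimJ F K`**: six 𝔰𝔩₂(ℂ)-coordinates per fine bond (three for `log 𝐔`, three for `𝐉`). [cite: Balaban1987RG1, (1.9) p.261] -/
def recordChartDimJ (K : ℕ) : ℕ := Fintype.card (ChartIdxJ F K)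

/-- The enumeration of the two-block chart indices. [cite: Balaban1987RG1, (1.9) p.261 (bookkeeping)] -/
def chartEquivJ (K : ℕ) : ChartIdxJ F K ≃ Fin (recordChartDimJ F K) := Fintype.equivFin _

/-- The 𝔰𝔩₂(ℂ) element of the `𝐔`-block on the fine bond `b`. [cite: Balaban1987RG1, p.258, (1.9) p.261] -/
def chartMatU (K : ℕ) (w : Fin (recordChartDimJ F K) → ℂ) (b : PBond (F.P K) 0) : MatA 2 :=
  ∑ a : Fin 3, w (chartEquivJ F K (b, Sum.inl a)) • sl2Gen a

/-- The 𝔰𝔩₂(ℂ) element of the `𝐉`-block on the fine bond `b`. [cite: Balaban1987RG1, (1.9) p.261] -/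
def chartMatJc (K : ℕ) (w : Fin (recordChartDimJ F K) → ℂ) (b : PBond (F.P K) 0) : MatA 2 :=
  ∑ a : Fin 3, w (chartEquivJ F K (b, Sum.inr a)) • sl2Gen a

open scoped Classical in
/-- **`χ` (two-block) — `recordChartJ F Mc k K X`**: `(w_U, w_J) ↦ (𝐔, 𝐉)` with `𝐔(b) = exp(Σ_a w_{U,b,a} τ_a)`, `𝐉(b) = Σ_a w_{J,b,a} τ_a` on the bonds in `X`,
`(1, 0)` off `X`, read in coordinates — the pair (1.9) is charted, not its first component only. [cite: Balaban1987RG1, (1.9) p.261, (1.10) p.262, (4.4) p.281] -/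
def recordChartJ (Mc k K : ℕ) (X : (recordDomSys F Mc k K).Dom) (w : Fin (recordChartDimJ F K) → ℂ) : Fin (recordBondCount F K) → ℂ :=
  encodeCfg F K (fun b => if b ∈ domBonds F Mc k K X then exp (chartMatU F K w b) else 1,
    fun b => if b ∈ domBonds F Mc k K X then chartMatJc F K w b else 0)

open scoped Classical in
/-- **`cX` (two-block) — `recordCXJ F Mc k K X`**: the chart-input indices (both blocks) on the bonds in `X`. [cite: Balaban1987RG1, (1.7) p.261] -/
def recordCXJ (Mc k K : ℕ) (X : (recordDomSys F Mc k K).Dom) : Finset (Fin (recordChartDimJ F K)) :=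
  Finset.univ.filter fun i => ((chartEquivJ F K).symm i).1 ∈ domBonds F Mc k K X

/-- The projection `π : M₂(ℂ) → 𝔰𝔩₂(ℂ) = 𝔤ᶜ` onto the traceless part, `A ↦ A − (tr A ∕ 2)·1` (print's «π denotes the projection … onto the algebra 𝔤ᶜ», (1.8)).
[cite: Balaban1987RG1, (1.8) p.261] -/
def sl2Proj : MatA 2 →ₗ[ℂ] MatA 2 :=
  LinearMap.id - (2 : ℂ)⁻¹ • ((LinearMap.toSpanSingleton ℂ (MatA 2) 1).comp (Matrix.traceLinearMap (Fin 2) ℂ ℂ))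

/-- The background field of the charted configuration as a `M₂(ℂ)ˣ`-valued fine-bond function (through `ιSU`), the argument of the current (1.8).
[cite: Balaban1987RG1, (1.8)–(1.9) p.261] -/
def recordBgUnits (k K : ℕ) (B : Fin (F.P K).d → Site (F.P K) (k + 1) → θ.Vβ) : PBond (F.P K) 0 → (MatA 2)ˣ :=
  fun b => ιSU 2 (recordBgField F θ k K B b)

/-- **THE CURRENT OF THE BACKGROUND FIELD** `J_{k+1}(W_B) = D^{ξ*} ξ⁻² π Im ∂U_{k+1}(W_B)` at `ξ = L^{−(k+1)}` — the tree's (1.8) `B12Eq18Current.current` at the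
rooted-gauge background field of the charted configuration. [cite: Balaban1987RG1, (1.8) p.261] -/
def recordCurrent (k K : ℕ) (B : Fin (F.P K).d → Site (F.P K) (k + 1) → θ.Vβ) : PBond (F.P K) 0 → MatA 2 :=
  B12Eq18Current.current sl2Proj ((F.P K).eta (k + 1)) (recordBgUnits F θ k K B)

/-- **`ι` (two-block) — `recordEmbJ F θ k K`**: `B ↦ (sl2Coord (log U_{k+1}(W_B)(b)), sl2Coord (J_{k+1}(W_B)(b)))_b` — the pair `(U_j, J_j)` of (1.9) in chart
coordinates, so that `recordChartJ … X (recordEmbJ … B)` is (1.9)'s argument cut to `X`. Instantiate `θ := thetaFill F a₀ ε₂₉`. [cite: Balaban1987RG1, (1.8)–(1.9) p.261, (4.35) p.290] -/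
def recordEmbJ (k K : ℕ) (B : Fin (F.P K).d → Site (F.P K) (k + 1) → θ.Vβ) : Fin (recordChartDimJ F K) → ℂ :=
  fun i => Sum.elim
    (fun a => sl2Coord (MatrixLog.mlog ((recordBgField F θ k K B ((chartEquivJ F K).symm i).1 : SU 2) : MatA 2)) a)
    (fun a => sl2Coord (recordCurrent F θ k K B ((chartEquivJ F K).symm i).1) a)
    ((chartEquivJ F K).symm i).2

/-- **(A2) DEFINITIONAL, two-block — `recordGkJ F θ k K a`**: `G_k := Dι(0)` on the basis fields (both the `log U`- and the `J`-responses). [cite: Balaban1987RG1, (4.35) p.290; Balaban1985Variational, Prop. 9] -/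
def recordGkJ (k K : ℕ) (a : θ.ιβ) (l : RespLabel F k K) (i : Fin (recordChartDimJ F K)) : ℂ :=
  letI := θ.instVβ₁; letI := θ.instVβ₂; letI := θ.instιβ
  fderiv ℝ (recordEmbJ F θ k K) 0 (Pi.single l.1 (Pi.single l.2 (θ.bV a))) i

/-- **`siteOf` (two-block) — `recordSiteOfJ F k K i`**: the unit-lattice label over a two-block chart index (its bond's direction and coarse source). [cite: Balaban1987RG1, (0.3) p.252, (4.35) p.290] -/
def recordSiteOfJ (k K : ℕ) (i : Fin (recordChartDimJ F K)) : RespLabel F k K :=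
  (((chartEquivJ F K).symm i).1.dir, coarsenTo (k + 1) ((chartEquivJ F K).symm i).1.src)

/-- **`jX` (two-block, CENTRED) — `recordJXJ F K`**: the centred window lift of two-block chart indices. [cite: Balaban1987RG1, (1.21) p.264] -/
def recordJXJ (K : ℕ) (i : Fin (recordChartDimJ F K)) : Fin (recordChartDimJ F (K + 1)) :=
  chartEquivJ F (K + 1) (Prod.map (liftBondCtr F K 0) id ((chartEquivJ F K).symm i))

/-- The adjoint action of a rotation on BOTH blocks of the two-block chart coordinates ((1.10): `𝐔 ↦ u𝐔u⁻¹`, `𝐉 ↦ R(u)𝐉`), as a function.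
[cite: Balaban1987RG1, (1.10) p.262, (4.8) p.283] -/
def recordAdFunJ (K : ℕ) (g : SU 2) (w : Fin (recordChartDimJ F K) → ℂ) : Fin (recordChartDimJ F K) → ℂ :=
  fun i => Sum.elim
    (fun a => sl2Coord ((g : MatA 2) * chartMatU F K w ((chartEquivJ F K).symm i).1 * ((g⁻¹ : SU 2) : MatA 2)) a)
    (fun a => sl2Coord ((g : MatA 2) * chartMatJc F K w ((chartEquivJ F K).symm i).1 * ((g⁻¹ : SU 2) : MatA 2)) a)
    ((chartEquivJ F K).symm i).2

/-- **`A` (two-block) — `recordAdJ F K g`**: the adjoint action on both blocks as a continuous linear map. [cite: Balaban1987RG1, (1.10) p.262, (4.13)–(4.14) p.284] -/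
def recordAdJ (K : ℕ) (g : SU 2) : (Fin (recordChartDimJ F K) → ℂ) →L[ℂ] (Fin (recordChartDimJ F K) → ℂ) :=
  LinearMap.toContinuousLinearMap
    { toFun := recordAdFunJ F K g
      map_add' := fun w w' => by
        have hc : ∀ A B : MatA 2, sl2Coord (A + B) = sl2Coord A + sl2Coord B := by
          intro A B; ext a; fin_cases a <;> simp [sl2Coord]; ring
        have hU : ∀ b, chartMatU F K (w + w') b = chartMatU F K w b + chartMatU F K w' b := by
          intro b; simp [chartMatU, add_smul, Finset.sum_add_distrib]
        have hJ : ∀ b, chartMatJc F K (w + w') b = chartMatJc F K w b + chartMatJc F K w' b := by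
          intro b; simp [chartMatJc, add_smul, Finset.sum_add_distrib]
        ext i
        simp only [recordAdFunJ, Pi.add_apply, hU, hJ, mul_add, add_mul, hc]
        cases ((chartEquivJ F K).symm i).2 <;> simp
      map_smul' := fun c w => by
        have hc : ∀ (z : ℂ) (A : MatA 2), sl2Coord (z • A) = z • sl2Coord A := by
          intro z A; ext a; fin_cases a <;> simp [sl2Coord]; ring
        have hU : ∀ b, chartMatU F K (c • w) b = c • chartMatU F K w b := by
          intro b; simp [chartMatU, Finset.smul_sum, smul_smul]
        have hJ : ∀ b, chartMatJc F K (c • w) b = c • chartMatJc F K w b := by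
          intro b; simp [chartMatJc, Finset.smul_sum, smul_smul]
        ext i
        simp only [recordAdFunJ, Pi.smul_apply, hU, hJ, Matrix.mul_smul, Matrix.smul_mul, hc, RingHom.id_apply]
        cases ((chartEquivJ F K).symm i).2 <;> simp }

/-- **print's (4.4)∕(3.14) DOMAIN, two-block — `recordDom44J F Mc k K X α₂`**: the three SCALED `𝐔`-clauses of `recordDom44` on `chartMatU` (`‖W‖ < α₂ξ`, first differences
`< α₂ξ²`, Laplacian `< α₂ξ³`) AND the CONSTANT-radius `𝐉`-clause `‖chartMatJc w b‖ < α₂` on the bonds in `X` (print's (1.14) «|𝐉| < γ₀», no ξ-power).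
[cite: Balaban1987RG1, (4.4) p.281, (3.14) p.272, (1.14) p.262] -/
def recordDom44J (Mc k K : ℕ) (X : (recordDomSys F Mc k K).Dom) (α₂ : ℝ) : Set (Fin (recordChartDimJ F K) → ℂ) :=
  {w | (∀ b ∈ domBonds F Mc k K X, ‖chartMatU F K w b‖ < α₂ * (F.P K).eta (k + 1)) ∧
    (∀ b ∈ domBonds F Mc k K X, ∀ μ : Fin (F.P K).d, (⟨b.src.shift μ, b.dir⟩ : PBond (F.P K) 0) ∈ domBonds F Mc k K X →
      ‖chartMatU F K w ⟨b.src.shift μ, b.dir⟩ - chartMatU F K w b‖ < α₂ * (F.P K).eta (k + 1) ^ 2) ∧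
    (∀ b ∈ domBonds F Mc k K X,
      (∀ μ : Fin (F.P K).d, (⟨b.src.shift μ, b.dir⟩ : PBond (F.P K) 0) ∈ domBonds F Mc k K X ∧
        (⟨b.src.unshift μ, b.dir⟩ : PBond (F.P K) 0) ∈ domBonds F Mc k K X) →
      ‖∑ μ : Fin (F.P K).d, (chartMatU F K w ⟨b.src.shift μ, b.dir⟩ - (2 : ℂ) • chartMatU F K w b + chartMatU F K w ⟨b.src.unshift μ, b.dir⟩)‖ <
        α₂ * (F.P K).eta (k + 1) ^ 3) ∧
    (∀ b ∈ domBonds F Mc k K X, ‖chartMatJc F K w b‖ < α₂)}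

/-- **The record response data, two-block chart + CENTRED two-volume layer** (`cX∕siteOf∕Gk∕jX` := the `…J` names, `wrap∕emb∕πc` := the `…Ctr` names).
[cite: Balaban1985Variational, Prop. 9; Balaban1987RG1, (1.9) p.261, (1.21) p.264, (4.35) p.290] -/
def recordResponse9DataJ (a : θ.ιβ) (Mc k : ℕ) :
    B12FormatPlus.Response9Data (recordDomSys F Mc k) (recordBondCount F) (recordChartDimJ F) 4 where
  Cc := recordCc F Mc k
  Λ := fun K => RespLabel F k K
  G := recordSiteGeom F Mc k
  ρ := fun K => recordRho F k K
  e := fun K => recordE F k K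
  cX := recordCXJ F Mc k
  siteOf := fun K => recordSiteOfJ F k K
  Gk := fun K => recordGkJ F θ k K a
  wrap := recordWrapCtr F Mc k
  emb := recordDomEmbCtr F Mc k
  jX := fun K _ => recordJXJ F K
  πc := fun K _ => recordCoordProjCtr F K

/-- The same from the base volume `K₀` on (member `n` = volume `K₀ + n`). [cite: Balaban1985Variational, Prop. 9; Balaban1987RG1, (1.21) p.264] -/
def recordResponse9DataFromJ (a : θ.ιβ) (Mc k K₀ : ℕ) :
    B12FormatPlus.Response9Data (fun n => recordDomSys F Mc k (K₀ + n)) (fun n => recordBondCount F (K₀ + n)) (fun n => recordChartDimJ F (K₀ + n)) 4 where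
  Cc := fun n => recordCc F Mc k (K₀ + n)
  Λ := fun n => RespLabel F k (K₀ + n)
  G := fun n => recordSiteGeom F Mc k (K₀ + n)
  ρ := fun n => recordRho F k (K₀ + n)
  e := fun n => recordE F k (K₀ + n)
  cX := fun n => recordCXJ F Mc k (K₀ + n)
  siteOf := fun n => recordSiteOfJ F k (K₀ + n)
  Gk := fun n => recordGkJ F θ k (K₀ + n) a
  wrap := fun n => recordWrapCtr F Mc k (K₀ + n)
  emb := fun n => recordDomEmbCtr F Mc k (K₀ + n)
  jX := fun n _ => recordJXJ F (K₀ + n)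
  πc := fun n _ => recordCoordProjCtr F (K₀ + n)

/-- RECEIPT (R-J): 27930's (1.19)-vehicle body over the two-block chart ∕ embedding and the centred layer. [cite: Balaban1987RG1, (1.6)–(1.7), (1.9) p.261, (1.18)–(1.19) p.263, (1.21) p.264] -/
def FormatPlusGAtJ (Mc k : ℕ) (a₀ ε₂₉ α₀ α₁ E₀ κ : ℝ) (v : Fin (k + 1) → ℝ) : Prop :=
  letI θ := thetaFill F a₀ ε₂₉
  letI := θ.instVβ₁; letI := θ.instVβ₂; letI := θ.instιβ
  B12FormatPlus.FormatPlusG (recordDomSys F Mc k) (recordBondCount F) (recordAct F) (recordUc F Mc k α₀ α₁) (recordCoords F Mc k)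
    (recordChartDimJ F) (recordChartJ F Mc k) (recordΦf F a₀ ε₂₉ k v) (recordEmbJ F θ k) (recordWrapCtr F Mc k) (recordDomEmbCtr F Mc k)
    (fun K _ => recordCoordProjCtr F K) E₀ κ

/-- RECEIPT (R-J): 27930's Ward-vehicle body over the two-block chart ∕ embedding and the centred layer. [cite: Balaban1987RG1, (1.6)–(1.7), (1.9) p.261, (1.18) p.263, (4.14) p.284] -/
def FormatPlusWAtJ (Mc k : ℕ) (a₀ ε₂₉ α₀ α₁ E₀ κ : ℝ) (v : Fin (k + 1) → ℝ) : Prop :=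
  letI θ := thetaFill F a₀ ε₂₉
  letI := θ.instVβ₁; letI := θ.instVβ₂; letI := θ.instιβ
  B12FormatPlus.FormatPlusW (recordDomSys F Mc k) (recordBondCount F) (recordUc F Mc k α₀ α₁) (recordCoords F Mc k) (recordChartDimJ F)
    (recordChartJ F Mc k) (recordΦf F a₀ ε₂₉ k v) (recordEmbJ F θ k) (recordWrapCtr F Mc k) (recordDomEmbCtr F Mc k)
    (fun K _ => recordCoordProjCtr F K) E₀ κ

/-- RECEIPT (R-J): 27932's repaired body — typer-1's `Chart44D` over the two-block chart and the two-block (4.4) domain. [cite: Balaban1987RG1, (4.4) p.281, (3.14) p.272] -/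
def Chart44DAtJ (Mc k : ℕ) (α₀ α₁ α₂ : ℝ) : Prop :=
  B12FormatPlus.Chart44D (recordDomSys F Mc k) (recordBondCount F) (recordUc F Mc k α₀ α₁) (recordChartDimJ F) (recordChartJ F Mc k)
    (fun K X => recordDom44J F Mc k K X α₂)

/-- RECEIPT (R-J): 27931's response half in the gauge norm of the two-block domain, CENTRED layer, window guard at the RADIUS `recordRNat`, from the base volume `K₀`.
[cite: Balaban1985Variational, Prop. 9; Balaban1987RG1, (1.9) p.261, (4.4) p.281, (1.21) p.264] -/
def Response9DAtJ (a : θ.ιβ) (Mc k K₀ : ℕ) (α₂ C₉ δ₀ : ℝ) : Prop :=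
  B12FormatPlus.Response9D (recordResponse9DataFromJ F θ a Mc k K₀) (fun n => recordChartJ F Mc k (K₀ + n)) (fun n => recordRNat F Mc k (K₀ + n))
    (fun n X => recordDom44J F Mc k (K₀ + n) X α₂) C₉ δ₀

/-- RECEIPT (R-J): lens-1's chart-equivariance row over the two-block names. [cite: Balaban1987RG1, (1.10) p.262, (4.8) p.283] -/
def ChartEquivariantAtJ (Mc k : ℕ) : Prop :=
  B12FormatPlus.ChartEquivariant (recordToG F) (recordAct F) (recordChartJ F Mc k) (recordAdJ F)

/-- RECEIPT (R-J): «no invariant covector» for the two-block adjoint action. [cite: Balaban1987RG1, (4.13)–(4.14) p.284] -/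
def NoInvariantCovectorAtJ (K : ℕ) : Prop :=
  B12FormatPlus.NoInvariantCovector (recordAdJ F K)

/-- RECEIPT (R-J): 27931's linearisation row for the two-block embedding. [cite: Balaban1987RG1, (4.35) p.290; Balaban1985Variational, Prop. 9] -/
def IotaRowAtJ (k K : ℕ) : Prop :=
  letI := θ.instVβ₁; letI := θ.instVβ₂
  ContDiffAt ℝ 2 (recordEmbJ F θ k K) 0 ∧ recordEmbJ F θ k K 0 = 0

/-! ## §17  (v8) THE SIXTEENTH NAME CLOSED: the fixed colour `recordAStar` (the record's `ιβ` IS `Fin (suChartDim 2)`, and `0 < suChartDim 2`) -/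

/-- **`aStar` — `recordAStar F a₀ ε₂₉ : (thetaFill F a₀ ε₂₉).ιβ`**: the fixed colour index of the (A2) responses, a CLOSED term (v1–v7 left it a parameter): the
record's basis index type is `Fin (suChartDim 2)` definitionally, and `suChartDim 2 > 0` because the chart of record is ONTO 𝔰𝔲(2) (`isSuChart_suChartMap`, clause 2)
and 𝔰𝔲(2) ∋ `!![0, 1; −1, 0] ≠ 0`.  ROW (A4) makes the choice immaterial. [cite: Balaban1987RG1, (1.20)–(1.21) p.264; Hall2015, Example 7.3] -/
def recordAStar (a₀ ε₂₉ : ℝ) : (thetaFill F a₀ ε₂₉).ιβ :=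
  (⟨0, by
    obtain ⟨-, hsurj, -, -⟩ := isSuChart_suChartMap 2
    by_contra h
    have hd : suChartDim 2 = 0 := by omega
    have hX : (!![0, 1; -1, 0] : Matrix (Fin 2) (Fin 2) ℂ).conjTranspose = -!![0, 1; -1, 0] := by
      ext i j; fin_cases i <;> fin_cases j <;> simp [Matrix.conjTranspose]
    have hT : (!![0, 1; -1, 0] : Matrix (Fin 2) (Fin 2) ℂ).trace = 0 := by simp [Matrix.trace]
    obtain ⟨v, hv⟩ := hsurj _ hX hT
    have hv0 : v = 0 := by
      funext i; exact absurd i.2 (by omega)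
    rw [hv0, map_zero] at hv
    have h01 := congrFun (congrFun hv 0) 1
    simp at h01⟩ : Fin (suChartDim 2))

/-- **`recordGkAt F a₀ ε₂₉ k K`** — the responses at the record's fill AND the record's colour (the two-block `recordGkJ` at `θ := thetaFill F a₀ ε₂₉`, `a := recordAStar F a₀ ε₂₉`):
the parameter-free `Gk` slot. [cite: Balaban1987RG1, (4.35) p.290] -/
def recordGkAt (a₀ ε₂₉ : ℝ) (k K : ℕ) : RespLabel F k K → Fin (recordChartDimJ F K) → ℂ :=
  recordGkJ F (thetaFill F a₀ ε₂₉) k K (recordAStar F a₀ ε₂₉)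

/-! ## §18  (v9, port-lead LEDGER v1.4 **T-3 = PT-H**) «Π-HOLOMORPHY AT THE RECORD»: the DATA of `B12BetaHolo.PiHoloSource` BY NAME —
the record's merged term family, its finite-volume (1.20)–(1.21)₁ and limiting (1.21) kernels, the real kernel family `Π^{(k+1)}(g, ·)` of (5.42)
in the LAST coupling `g = g_k`, the complexified printed limit `Pℓ`, the window labels of the OFF-DIAGONAL pair `(μ, ν) = (0, 1)` («μ ≠ ν»,
(1.22) p.264 — `d := 4`), the cut responses (the `hn` slot), the (5.42) flow along an earlier history (the tower's `flow` slot, `beta_eq` by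
construction), and two receipts.  Definitions only; the faces (`rfl` ∕ on-the-box ∕ θ-blindness of β ∕ the `PiHoloSource` constructor at these
names ∕ the tower-free β-box) are in the lemma files. [cite: Balaban1987RG1, (1.20)–(1.22) p.264, (4.37) p.291 = (5.1) p.292, (5.10) p.293, (5.42) p.297] -/

/-- **The record's MERGED TERM FAMILY** `𝓝_{k+1}(g₀, …, g_k; ·)` on the unit lattice `T^{(k+1)}` of `T_K` ((1.6)∕(2.13), matrix carrier, read through
the β-layer transport `TβOfRecord₁₃` and the (2.9) species at `θ := thetaFill F a₀ ε₂₉`): THE object `recordΦf` (§9) charts and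
`PolLimitsExistOfRecord₁₃ (thetaFill F a₀ ε₂₉)` quantifies over (both `rfl`, lemma file). [cite: Balaban1987RG1, (1.6) p.261, (2.13) p.268] -/
def recordTerms (a₀ ε₂₉ : ℝ) : TermFamily1 F (MatA 2) :=
  mergedTermFamilyMatT F 2 (TβOfRecord₁₃ F 2) (chiβOfRecord₁₃ F 2 (thetaFill F a₀ ε₂₉)) (thetaFill F a₀ ε₂₉).εbg

/-- **(1.20)–(1.21)₁ AT FINITE VOLUME — `recordPvol F a₀ ε₂₉ k v K`**: the scalar vacuum-polarization kernel of the record's term at step `k`, history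
`v = (g₀, …, g_k)`, on the `K`-th torus, windowed into `ℤ⁴` (`Node00.polWindow`; typer-1's `Pol120` slot `Pvol` at the record).
[cite: Balaban1987RG1, (1.20)–(1.21) p.264] -/
def recordPvol (a₀ ε₂₉ : ℝ) (k : ℕ) (v : Fin (k + 1) → ℝ) (K : ℕ) : B12Beta.Kernel 4 :=
  letI θ := thetaFill F a₀ ε₂₉
  letI := θ.instVβ₁; letI := θ.instVβ₂; letI := θ.instιβ
  fun μ ν z => polWindow F K (k + 1) (recordTerms F a₀ ε₂₉ k v K) θ.ρ8 θ.bV μ ν z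

/-- **(1.21) «T^{(k+1)} ↗ Z^d» — `recordPlim F a₀ ε₂₉ k v`**: the limiting kernel of the record's term at step `k` and history `v` (`Node00.polLimit`, the
TOTAL reading; it IS the limit under `PolLimitsExistOfRecord₁₃`).  Along a coupling sequence `w` it is `Node00.U3OfKernels.kernelA F (recordTerms …) ρ₈ bV w k`
(`rfl`).  ON THE BOX `]0, ½]^{k+1}` the record's β IS its (1.22)-moment: `betaOfRecord₁₃ F 2 (thetaFill F a₀ ε₂₉) k v = secondMoment (recordPlim F a₀ ε₂₉ k v) 0 1`
(lemma file). [cite: Balaban1987RG1, (1.21)–(1.22) p.264] -/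
def recordPlim (a₀ ε₂₉ : ℝ) (k : ℕ) (v : Fin (k + 1) → ℝ) : B12Beta.Kernel 4 :=
  letI θ := thetaFill F a₀ ε₂₉
  letI := θ.instVβ₁; letI := θ.instVβ₂; letI := θ.instιβ
  polLimit F (k + 1) (fun K => recordTerms F a₀ ε₂₉ k v K) θ.ρ8 θ.bV

/-- **`Π^{(k+1)}(g, ·)` — `recordPk F a₀ ε₂₉ k v : ℝ → B12Beta.Kernel 4`**, THE `Pk` SLOT OF `B12BetaHolo.PiHoloSource` BY NAME: one real kernel per real
value `g` of the LAST coupling `g_k` (the earlier history `g₀, …, g_{k−1}` = the first `k` entries of `v`; the last entry of `v` is overwritten by `g`),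
print's «Π^{(k+1)}_{μν}(g, x)» of (5.42)∕(1.22).  `recordPk … k v (v (Fin.last k)) = recordPlim … k v`. [cite: Balaban1987RG1, (1.21)–(1.22) p.264, (5.42) p.297] -/
def recordPk (a₀ ε₂₉ : ℝ) (k : ℕ) (v : Fin (k + 1) → ℝ) : ℝ → B12Beta.Kernel 4 :=
  fun t => recordPlim F a₀ ε₂₉ k (Function.update v (Fin.last k) t)

/-- **`Pℓ` — `recordPℓ F a₀ ε₂₉ k v t z := (Π^{(k+1)}_{01}(t, z) : ℂ)`**: the printed real limit at real couplings, complexified, for the off-diagonal pair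
`(μ, ν) = (0, 1)` (the `Pℓ` slot of `B12PolarizationHolo`; `recordPk … t 0 1 z = (recordPℓ … t z).re`, lemma file). [cite: Balaban1987RG1, (1.21)–(1.22) p.264] -/
def recordPℓ (a₀ ε₂₉ : ℝ) (k : ℕ) (v : Fin (k + 1) → ℝ) : ℝ → (Fin 4 → ℤ) → ℂ :=
  fun t z => ((recordPk F a₀ ε₂₉ k v t 0 1 z : ℝ) : ℂ)

/-- **The ORIGIN window label, direction `μ = 0`**: `recordLabel₀ F k K = recordE F k K 0 0` (the first slot of every (1.20) second derivative
`Π_{01}(0, z) = ∂²𝐄 ∕ ∂B_0(0) ∂B_1(z)`).  The pair `(μ, ν) = (0, 1)` is OFF-DIAGONAL as (1.22) demands («μ, ν arbitrary, μ ≠ ν»); a single window map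
`e : ℤ⁴ → Λ` evaluated at `0` and at `z` cannot carry two directions at `z = 0`, whence two names. [cite: Balaban1987RG1, (1.20)–(1.22) p.264] -/
def recordLabel₀ (k K : ℕ) : RespLabel F k K := recordE F k K 0 0

/-- **The RUNNING window label, direction `ν = 1`**: `recordLabel₁ F k K z = recordE F k K 1 z` (the second slot; `recordRho` of the pair is `|z|₁` inside the
window — ROW W of the lemma file). [cite: Balaban1987RG1, (1.20)–(1.22) p.264] -/
def recordLabel₁ (k K : ℕ) (z : Fin 4 → ℤ) : RespLabel F k K := recordE F k K 1 z

/-- **The CUT RESPONSES — the `hn` slot**: `recordHn F a₀ ε₂₉ Mc k K X l` = the response `G_k(l)` of the two-block coordinate embedding at the fixed colour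
(`recordGkAt`, §17) CUT to the chart inputs of `X` (`B12FormatPlus.cutTo (recordCXJ …)`) — literally the vector typer-1's `Response9D` bounds in the gauge of
the (4.4) domain (`cutTo (R.cX n X) (R.Gk n y)` at `R := recordResponse9DataFromJ … (recordAStar …)`, `K = recordK₀ F Mc k + n`). [cite: Balaban1987RG1, (4.35) p.290, p.282; Balaban1985Variational, Prop. 9] -/
def recordHn (a₀ ε₂₉ : ℝ) (Mc k K : ℕ) (X : (recordDomSys F Mc k K).Dom) (l : RespLabel F k K) : Fin (recordChartDimJ F K) → ℂ :=
  B12FormatPlus.cutTo (recordCXJ F Mc k K X) (recordGkAt F a₀ ε₂₉ k K l)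

/-- **THE (5.42) FLOW OF RECORD along the coupling sequence `w` — the tower's `flow` slot**: couplings `w`, and `β_{k+1}(t) := Σ_x Π^{(k+1)}_{01}(w₀, …, w_{k−1}, t; x) x₀ x₁`
BY CONSTRUCTION (`β_0 := 0`, unread), so that the `beta_eq` field of `PiHoloSource T c k` is `rfl` for ANY tower `T` with `T.flow = recordBetaFlow F a₀ ε₂₉ w` (PT-J's
carrier).  ON THE BOX it is the β of record: `v ∈ ]0, ½]^{k+1} → betaOfRecord₁₃ F 2 (thetaFill F a₀ ε₂₉) k v = (recordBetaFlow F a₀ ε₂₉ w).β (k + 1) (v (Fin.last k))` whenever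
`FlowStep.prefixOf w k = v`, and `betaOfRecord₁₃` at 2′'s θ `theta13OfThm1CCMWZB F 2 j ½ a₀ ε₀ ε₂₉ B₃ B₃' a₀ a₁ 0 0` IS `betaOfRecord₁₃ (thetaFill F a₀ ε₂₉)` (`rfl`) — lemma file.
[cite: Balaban1987RG1, (5.42) p.297, (1.22) p.264, (0.20) p.256] -/
def recordBetaFlow (a₀ ε₂₉ : ℝ) (w : ℕ → ℝ) : Flow where
  g := w
  β := fun j t => match j with
    | 0 => 0
    | j + 1 => B12Beta.secondMoment (recordPk F a₀ ε₂₉ j (FlowStep.prefixOf w j) t) 0 1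

/-- **The uniform-margin coupling neighbourhood** `recordCStrip γ r` = the open `r`-thickening of `[0, γ] ⊂ ℂ` (CRIT-1's `Crit1GlueRho2.cStrip`, same body; the `U` slot
with the margin `r` of `PiHoloSource.ball_subset` displayed). [cite: Balaban1987RG1, p.266 (analytic alternative), p.263 («absolute constants»)] -/
def recordCStrip (γ r : ℝ) : Set ℂ := Metric.thickening r ((fun t : ℝ => (t : ℂ)) '' Set.Icc 0 γ)

/-- **RECEIPT «Π-HOLOMORPHY AT THE RECORD» (step `k`, earlier history in `v`, neighbourhood `U ⊇ [0, γ]`, constants `C, δ₁`)** — exactly the ANALYTIC fields of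
`B12BetaHolo.PiHoloSource` (`U, isOpen, Pc, holo, C, δ₁, δ₁_pos, decay, re_eq`) with `d := 4`, `(μ, ν) := (0, 1)` and `Pk := recordPk F a₀ ε₂₉ k v` BY NAME: the
`(0, 1)`-component of the record's real kernel family is, on `[0, γ]`, the real part of a function holomorphic on `U` obeying (5.10) on `U`.  The margin `r`
is recovered from `IsOpen U` (`B12BetaHolo.nonempty_piHoloSource`); the tower fields `beta_eq`∕`le_beta'` belong to the join (lemma file
`piHoloSource_of_recordPiHoloAt`).  Prop-valued; asserts nothing; NOT junk-inhabitable (`re_eq` pins `Re Pc` to the NAMED kernel; `Pc := 0` forces `Π^{(k+1)}_{01} ≡ 0`).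
[cite: Balaban1987RG1, (5.10) p.293, (5.42) p.297, p.266 (analytic alternative)] -/
def RecordPiHoloAt (a₀ ε₂₉ : ℝ) (k : ℕ) (v : Fin (k + 1) → ℝ) (U : Set ℂ) (γ C δ₁ : ℝ) : Prop :=
  IsOpen U ∧ (∀ t ∈ Set.Icc (0 : ℝ) γ, (t : ℂ) ∈ U) ∧ 0 < δ₁ ∧
    ∃ Pc : ℂ → (Fin 4 → ℤ) → ℂ, (∀ z, DifferentiableOn ℂ (fun g => Pc g z) U) ∧
      (∀ z, ∀ g ∈ U, ‖Pc g z‖ ≤ C * Real.exp (-δ₁ * B12Sec2to5.l1 z)) ∧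
      (∀ z, ∀ t ∈ Set.Icc (0 : ℝ) γ, recordPk F a₀ ε₂₉ k v t 0 1 z = (Pc t z).re)

/-- **RECEIPT «Π-HOLOMORPHY AT THE RECORD, UNIFORMLY»**: ONE margin `r > 0` and ONE pair `(C, δ₁)` for every step `k` and every history `v ∈ ]0, γ]^{k+1}`, on the
`r`-thickening of `[0, γ]` — p.263 «absolute constants»; the shape stub 2′ consumes (lemma file `betaBox_of_recordPiHoloUniform`: ⟹
`BetaUpperH β′₅.₁₀ γ (betaOfRecord₁₃ …) ∧ BetaLowerH (−β′₅.₁₀) γ (betaOfRecord₁₃ …)` for `γ ≤ ½`, `β′₅.₁₀ = betaPrime510 4 C δ₁`).  Asserts nothing.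
[cite: Balaban1987RG1, p.263–264 (Thm 3, «uniformly bounded»), (5.10) p.293] -/
def RecordPiHoloUniform (a₀ ε₂₉ γ r C δ₁ : ℝ) : Prop :=
  0 < r ∧ ∀ (k : ℕ) (v : Fin (k + 1) → ℝ), v ∈ FlowStep.Box γ k → RecordPiHoloAt F a₀ ε₂₉ k v (recordCStrip γ r) γ C δ₁

/-! ## §19  (v10, CRIT-1 g33 RULING (Φ3) nodeO STATUS l.3826 «make the core FAMILY-PARAMETRIC», Q-5 (β)) THE GENERIC Π-LAYER over a term family
`fam : TermFamily1 F 𝔄`, a chart representation `ρ : V →L[ℝ] 𝔄` and a colour basis `bV` — selection-FREE names (no cut-off, no minimiser selector, no θ inside);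
the §18 record names ARE their instances at `(recordTerms F a₀ ε₂₉, θfill.ρ8, θfill.bV)` (`rfl`, lemma file 3) and the [Ax-4] names (§20, after [Ax-3]) are their
instances at `recordTermsAx`.  T-3's text is cut over THESE (typer-1), the record∕Ax corollaries instantiate. [cite: Balaban1987RG1, (1.20)–(1.22) p.264, (5.10) p.293, (5.42) p.297] -/

section Generic

variable {𝔄 : Type*} [NormedRing 𝔄] [NormedAlgebra ℝ 𝔄]
variable {V : Type*} [NormedAddCommGroup V] [NormedSpace ℝ V] {ι : Type*} [Fintype ι]

/-- **`Φf` of a term family — `ΦfOf F fam ρ k v K`**: the functional family `B ↦ fam k v K (exp ρB)` (the exp-chart of `B12PolarizationTensor120`), complexified.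
`recordΦf` is its instance at `recordTerms` (`rfl`). [cite: Balaban1987RG1, (1.6) p.261, (1.20) p.264] -/
def ΦfOf (fam : TermFamily1 F 𝔄) (ρ : V →L[ℝ] 𝔄) (k : ℕ) (v : Fin (k + 1) → ℝ) (K : ℕ) :
    (Fin (F.P K).d → Site (F.P K) (k + 1) → V) → ℂ :=
  fun B => ((B12PolarizationTensor120.expChart (fam k v K) ρ B : ℝ) : ℂ)

/-- **(1.20)–(1.21)₁ of a term family at finite volume — `pvolOf F fam ρ bV k v K`** (`Node00.polWindow`, windowed into `ℤ⁴`). [cite: Balaban1987RG1, (1.20)–(1.21) p.264] -/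
def pvolOf (fam : TermFamily1 F 𝔄) (ρ : V →L[ℝ] 𝔄) (bV : Module.Basis ι ℝ V) (k : ℕ) (v : Fin (k + 1) → ℝ) (K : ℕ) : B12Beta.Kernel 4 :=
  fun μ ν z => polWindow F K (k + 1) (fam k v K) ρ bV μ ν z

/-- **(1.21) «T^{(k+1)} ↗ Z^d» of a term family — `plimOf F fam ρ bV k v`** (`Node00.polLimit`; = `U3OfKernels.kernelA F fam ρ bV w k` at `v = histPrefix w k`, `rfl`).
ON THE BOX `v ∈ ]0, θ₈.γ]^{k+1}`: `betaOfRecord₈Tχ F N T χ θ₈ k v = secondMoment (plimOf F (mergedTermFamilyMatT F N T χ θ₈.εbg) θ₈.ρ8 θ₈.bV k v) 0 1` (lemma file 3).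
[cite: Balaban1987RG1, (1.21)–(1.22) p.264] -/
def plimOf (fam : TermFamily1 F 𝔄) (ρ : V →L[ℝ] 𝔄) (bV : Module.Basis ι ℝ V) (k : ℕ) (v : Fin (k + 1) → ℝ) : B12Beta.Kernel 4 :=
  polLimit F (k + 1) (fun K => fam k v K) ρ bV

/-- **`Π^{(k+1)}(g, ·)` of a term family — `pkOf F fam ρ bV k v : ℝ → B12Beta.Kernel 4`**, the `Pk` slot of `B12BetaHolo.PiHoloSource`: one real kernel per real value `g`
of the LAST coupling (earlier history = the first `k` entries of `v`). [cite: Balaban1987RG1, (1.21)–(1.22) p.264, (5.42) p.297] -/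
def pkOf (fam : TermFamily1 F 𝔄) (ρ : V →L[ℝ] 𝔄) (bV : Module.Basis ι ℝ V) (k : ℕ) (v : Fin (k + 1) → ℝ) : ℝ → B12Beta.Kernel 4 :=
  fun t => plimOf F fam ρ bV k (Function.update v (Fin.last k) t)

/-- **`Pℓ` of a term family — `pℓOf F fam ρ bV k v t z := (Π^{(k+1)}_{01}(t, z) : ℂ)`**, the `Pℓ` slot (pair `(μ, ν) = (0, 1)`). [cite: Balaban1987RG1, (1.21)–(1.22) p.264] -/
def pℓOf (fam : TermFamily1 F 𝔄) (ρ : V →L[ℝ] 𝔄) (bV : Module.Basis ι ℝ V) (k : ℕ) (v : Fin (k + 1) → ℝ) : ℝ → (Fin 4 → ℤ) → ℂ :=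
  fun t z => ((pkOf F fam ρ bV k v t 0 1 z : ℝ) : ℂ)

/-- **The (5.42) flow of a term family along the coupling sequence `w` — `betaFlowOf F fam ρ bV w : Flow`** (the tower's `flow` slot): couplings `w`,
`β_{k+1}(t) := Σ_x Π^{(k+1)}_{01}(w₀, …, w_{k−1}, t; x) x₀x₁` BY CONSTRUCTION (`β_0 := 0`), so `PiHoloSource.beta_eq` is `rfl` for any tower `T` with `T.flow = betaFlowOf …`.
[cite: Balaban1987RG1, (5.42) p.297, (1.22) p.264, (0.20) p.256] -/
def betaFlowOf (fam : TermFamily1 F 𝔄) (ρ : V →L[ℝ] 𝔄) (bV : Module.Basis ι ℝ V) (w : ℕ → ℝ) : Flow where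
  g := w
  β := fun j t => match j with
    | 0 => 0
    | j + 1 => B12Beta.secondMoment (pkOf F fam ρ bV j (FlowStep.prefixOf w j) t) 0 1

/-- **RECEIPT «Π-HOLOMORPHY» of a term family (step `k`, earlier history in `v`, neighbourhood `U ⊇ [0, γ]`, constants `C, δ₁`)** — the ANALYTIC fields of
`B12BetaHolo.PiHoloSource` (`isOpen, Pc, holo, C, δ₁, δ₁_pos, decay, re_eq`) with `d := 4`, `(μ, ν) := (0, 1)`, `Pk := pkOf F fam ρ bV k v`; the only `∃` is the holomorphic
extension `Pc`, pinned on `[0, γ]` by `re_eq`.  Prop-valued; asserts nothing. [cite: Balaban1987RG1, (5.10) p.293, (5.42) p.297, p.266 (analytic alternative)] -/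
def PiHoloAtOf (fam : TermFamily1 F 𝔄) (ρ : V →L[ℝ] 𝔄) (bV : Module.Basis ι ℝ V) (k : ℕ) (v : Fin (k + 1) → ℝ) (U : Set ℂ) (γ C δ₁ : ℝ) : Prop :=
  IsOpen U ∧ (∀ t ∈ Set.Icc (0 : ℝ) γ, (t : ℂ) ∈ U) ∧ 0 < δ₁ ∧
    ∃ Pc : ℂ → (Fin 4 → ℤ) → ℂ, (∀ z, DifferentiableOn ℂ (fun g => Pc g z) U) ∧
      (∀ z, ∀ g ∈ U, ‖Pc g z‖ ≤ C * Real.exp (-δ₁ * B12Sec2to5.l1 z)) ∧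
      (∀ z, ∀ t ∈ Set.Icc (0 : ℝ) γ, pkOf F fam ρ bV k v t 0 1 z = (Pc t z).re)

/-- **RECEIPT «Π-HOLOMORPHY, UNIFORMLY» of a term family**: ONE margin `r > 0` and ONE pair `(C, δ₁)` for every step `k` and every history `v ∈ ]0, γ]^{k+1}`, on the
`r`-thickening of `[0, γ]` (p.263 «absolute constants») — the consequent shape of T-3 (CRIT-1 (Φ2)) and the antecedent of the tower-free β-box (lemma file 3).  Asserts nothing.
[cite: Balaban1987RG1, p.263–264 (Thm 3), (5.10) p.293] -/
def PiHoloUniformOf (fam : TermFamily1 F 𝔄) (ρ : V →L[ℝ] 𝔄) (bV : Module.Basis ι ℝ V) (γ r C δ₁ : ℝ) : Prop :=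
  0 < r ∧ ∀ (k : ℕ) (v : Fin (k + 1) → ℝ), v ∈ FlowStep.Box γ k → PiHoloAtOf F fam ρ bV k v (recordCStrip γ r) γ C δ₁

end Generic

end Summit.QuantumFields.YangMills.Theorems.K0RecordFormatNames

end
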